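import Literature.NumberTheory.LFunctions.ZeroDetectionWindow
import Literature.NumberTheory.LFunctions.DensityHypothesisStatus
import HarnessLib

/-!
# Zero-density estimates from large value bounds: the finitary exponent `LV(σ, τ) ≤ ρ`, Jutila's bound in that language, and the density hypothesis on `[25/32, 1]` from Bourgain's large values inequality

LABEL (line 1): **NOT RH-BEARING** — every statement here converts bounds for the number of large
values of Dirichlet polynomials into COUNTS of zeros of `ζ` off the critical line; a zero-density
estimate never empties the strip (`Literature.Barriers.RiemannHypothesis.LindelofBacklund`).
RH-FREE literature. Nothing in this file bears on the truth of RH.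

Topic `NumberTheory/LFunctions`, family RH; bears on the LADDER-RH §4 HELD row `DensityLadder`
(`Summits/RiemannHypothesis/RiemannHypothesis/Theses/DensityLadder.lean`, crux X2
`DensityBelowBourgain`), whose route file asks ("DEFINITION REQUESTS") for "a finitary
`LargeValueBound σ τ ρ : Prop` (TTY Def. 25/27) so Lemma 39 / Cor 41–43 are stated once" and for
the literature floor `ZeroDensityEstimate (fun _ ↦ 2) (25/32)` (Bourgain 2000).

Sources: T. Tao, T. Trudgian, A. Yang, *New exponent pairs, zero density estimates, and zero
additive energy estimates: a systematic approach*, arXiv:2501.16779 (2025) [`TaoTrudgianYang2025`]: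
Definition 25 (large value pattern), Definition 27 (large value exponent `LV(σ,τ)`, with its
NON-ASYMPTOTIC form printed on p. 12), the display `(jutila-lvt)` after Theorem 31 (Jutila's
large values theorem as the bound `LV(σ,τ) ≤ max(2 − 2σ, τ + (4 − 2/k) − (6 − 2/k)σ, τ + (6 − 8σ)k)`),
Theorem 32 (ii) (Bourgain's large values theorem, [`Bourgain2000`]), Corollaries 42–43 and
Theorem 45 (zero density estimates from large value estimates at `τ₀ ≤ 3/2`), and the proof of
Theorem 51 in the case `38/49 ≤ σ ≤ 4/5` (pp. 19–20: the choice of `α₁, α₂`).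
J. Bourgain, *On large values estimates for Dirichlet polynomials and the density hypothesis for
the Riemann zeta function*, IMRN 2000:3, 133–146 [`Bourgain2000`]: "the density hypothesis
`A(σ) ≤ 2` holds for all `σ > 25/32`" (as recalled by TTY before Theorem 51).

## What this file proves (definitions and theorems only; NO named fact is introduced)

* `LargeValueBound σ τ ρ` — the finitary predicate "`LV(σ, τ) ≤ ρ`" (TTY Definition 27,
  non-asymptotic form), in the tree's binder conventions; `LargeValueBound.mono`.
* `jutila_largeValues_shape` — Jutila's large values theorem (the tree THEOREM
  `Jutila1977_largeValues_holds`, Jutila 1977 (1.4)) moved from the line `Re s = 1`, points in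
  `[−T, T]` and `N ≤ n < 2N` to the tree's zero-detection shape (`Re s = 0`, points in `[0, T]`,
  `N ≤ n ≤ 2N`), for every `k ≥ 1`;
  `largeValueBound_jutila` — hence `LargeValueBound σ τ (max (2−2σ) (max (τ+(4−2/k)−(6−2/k)σ) (τ+(6−8σ)k)))`
  (TTY `(jutila-lvt)`), PROVED.
* `largeValuesOnWindow_of_largeValueBound` — compactness in `τ`: bounds `LV(σ,τ) ≤ κτ` for every
  `τ ∈ [1, 1/α]` give the UNIFORM window hypothesis of `ZeroDetectionWindow.lean`
  (`#W ≤ C T^{κ+ε}` for `T^α ≤ N ≤ T`);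
  `isBigO_zetaZeroCountRe_of_largeValueBound` — TTY Corollary 43 at `1 ≤ τ₀ ≤ 3/2` in
  `LV`-language: `LV(σ,τ) ≤ τ(3−3σ)/τ₀` for `1 ≤ τ ≤ τ₀` gives `N(σ,T) ≪ T^{(3/τ₀)(1−σ)+ε}`, PROVED
  from the tree's window zero detection `isBigO_zetaZeroCountRe_of_largeValuesOnWindow`.
* `zeroDensity_bourgain_of_theorem_32` — **Bourgain's theorem "`A(σ) ≤ 2` for `σ ≥ 25/32`"
  (`ZeroDensityEstimate (fun _ ↦ 2) (25/32)`) PROVED FROM THE HYPOTHESIS that Bourgain's large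
  values inequality holds in the form of TTY Theorem 32 (ii)** (an explicit binder `h32`, NOT a
  definition and NOT a named fact of the tree — Bourgain's 2000 paper is a separate corpus; this
  file isolates exactly which large-values inequality the density statement rests on): for
  `25/32 ≤ σ ≤ 11/14` and `1 ≤ τ ≤ 3/2` the bound `LV(σ,τ) ≤ 2τ(1−σ)`
  (`largeValueBound_two_mul_of_theorem_32`) is Jutila's (`k = 3`) when `τ(2σ−1) ≤ 24σ−18` and
  otherwise Bourgain's with TTY's choice `α₂ = max(5τ/4 − 1 − σ, 0)`, `α₁ = τ/3 − (2/3)(7σ−5) − α₂/6`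
  (proof of Theorem 51, case `38/49 ≤ σ ≤ 4/5`, run at `τ₀ = 3/2`; the five-term arithmetic is
  `bourgain_terms_le_two_mul`); then Corollary 43 at `τ₀ = 3/2`; on `[11/14, 1]` the tree's
  unconditional `zeroDensity_jutila`. Same conclusion as `zeroDensity_bourgain_of_theorem_51`
  (`ZeroDensityBourgain.lean`, from the BOUNDARY fact `TaoTrudgianYang2025_theorem_51`), here
  resting on the large-values inequality alone.
* `isBigO_zetaZeroCountRe_theorem_51_of_theorem_32` — **TTY Theorem 51's exponent
  `A(σ) ≤ max(2/(9σ−6), 9/(8(2σ−1)))` on the `ζ`-free sub-range `17/22 ≤ σ ≤ 25/32`** (where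
  `τ₀(σ) = min(9(3σ−2)/2, 8(2σ−1)/3) ≤ 3/2`), pointwise in `σ`, PROVED from `h32`: Jutila with
  `k = 4` on `1 ≤ τ ≤ 27/20` and Theorem 32 (ii) with the printed case-wise `α₁, α₂` on
  `27/20 ≤ τ ≤ τ₀(σ)` (`largeValueBound_case_one/two_of_theorem_32`,
  `bourgain_terms_le_case_one/two`), then Corollary 43 at `τ₀(σ)`. See the note before
  `largeValueBound_of_jutila_four` on why `k = 4` (not only the printed `k = 3`) is used.
* `TaoTrudgianYang2025.theorem_51_of_theorem_32_le` — **the same in the PRINTED form of TTY's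
  Definition 37** ("for every `ε > 0` there exists `C, δ > 0` such that `N(σ−δ, T) ≤ C T^{A(1−σ)+ε}`
  whenever `T ≥ C`"): literally the body of the tree's BOUNDARY fact `TaoTrudgianYang2025_theorem_51`
  (`ZeroDensityBourgain.lean`) with the range `σ ≤ 4/5` cut back to `σ ≤ 25/32`, PROVED from `h32`
  (the pointwise bound at `σ − δ`, available from `σ − δ ≥ 193/250`, and the continuity of the
  exponent, `ttyExponent51_sub_le`).

Design: `N` is a positive integer and the Dirichlet polynomial is `∑_{N ≤ n ≤ 2N} a_n n^{it}`
(TTY: real `N > 1`, `n ∈ [N, 2N]`, `n^{−it}`; the sign of `t` is immaterial — conjugate the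
coefficients — and the interval `J` is normalised to `[0, T]` as TTY remark after Definition 27).
"`LV(σ,τ) ≤ ρ`" is rendered by the printed non-asymptotic form with `ρ` in place of the infimum;
since that form has the `+ε` built in, `LV(σ,τ) ≤ ρ` holds iff the form holds for `ρ` itself.
What is NOT here: Bourgain's large values theorem itself (TTY Theorem 32) — not in the tree, no
held primary text (IMRN 2000); TTY Theorem 51 itself (the tree's BOUNDARY fact
`TaoTrudgianYang2025_theorem_51`, `σ ∈ [17/22, 4/5]`): for `σ > 25/32` its exponents `A(σ) < 2` need
a second external input, the twelfth-moment bound `LV_ζ(σ,τ) ≤ 2τ + 6 − 12σ` (TTY `(twelfth-bound)`,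
Heath-Brown 1978), fed into the `ζ`-branch of Corollary 43, which the tree's window detection
(fourth moment, `κ ≥ 2 − 2σ`) does not take — so the fact is NOT concluded by name here; on the
sub-range `17/22 ≤ σ ≤ 25/32` its exponent is proved pointwise in `σ` (TTY's Definition 37 asks in
addition for uniformity on a window `[σ−δ, σ]`, not restated here).
-/

noncomputable section

open Real Set Filter Topology Complex MeasureTheory Finset Asymptotics

namespace Literature.NumberTheory.LFunctions

/-! ## The finitary large value exponent bound `LV(σ, τ) ≤ ρ` -/

/-- **`LV(σ, τ) ≤ ρ`, finitary form** (Tao–Trudgian–Yang 2025, Definition 25 "large value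
pattern" and Definition 27 "large value exponent", non-asymptotic form, p. 12: "`LV(σ,τ)` is the
infimum of all real numbers `ρ` such that for every (fixed) `ε > 0` there exists `C, δ > 0` such that
if `(N, T, V, (a_n)_{n ∈ [N,2N]}, J, W)` is a large value pattern with `N ≥ C` and
`N^{τ−δ} ≤ T ≤ N^{τ+δ}`, `N^{σ−δ} ≤ V ≤ N^{σ+δ}`, then one has `|W| ≤ C N^{ρ+ε}`"; a large value
pattern: `a_n` `1`-bounded, `J` an interval of length `T` — here `[0, T]`, w.l.o.g. by the remark
after Definition 27 — and `W ⊂ J` `1`-separated with `|∑_{n ∈ [N,2N]} a_n n^{−it}| ≥ V` on `W`).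
`LargeValueBound σ τ ρ` is that claim for the number `ρ` (so `LV(σ,τ) ≤ ρ ↔ LargeValueBound σ τ ρ`,
the `+ε` being built in). Tree conventions: `N ∈ ℕ`, the sum over `Finset.Icc N (2N)`, and `n^{it}`
in place of `n^{−it}` (replace `a_n` by its conjugate). A parametrised predicate, not a named fact.
[cite: TaoTrudgianYang2025, Definition 25 and Definition 27 (non-asymptotic form), p. 12] -/
def LargeValueBound (σ τ ρ : ℝ) : Prop :=
  ∀ ε : ℝ, 0 < ε → ∃ C δ : ℝ, 0 < δ ∧
    ∀ (N : ℕ) (T V : ℝ) (a : ℕ → ℂ) (W : Finset ℝ),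
      C ≤ (N : ℝ) → (N : ℝ) ^ (τ - δ) ≤ T → T ≤ (N : ℝ) ^ (τ + δ) →
      (N : ℝ) ^ (σ - δ) ≤ V → V ≤ (N : ℝ) ^ (σ + δ) →
      (∀ n, ‖a n‖ ≤ 1) → (∀ t ∈ W, 0 ≤ t ∧ t ≤ T) →
      (∀ t ∈ W, ∀ t' ∈ W, t ≠ t' → 1 ≤ |t - t'|) →
      (∀ t ∈ W, V ≤ ‖∑ n ∈ Finset.Icc N (2 * N), a n * (n : ℂ) ^ ((t : ℂ) * I)‖) →
      (W.card : ℝ) ≤ C * (N : ℝ) ^ (ρ + ε)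

/-- Monotonicity of `LV(σ,τ) ≤ ρ` in `ρ`. [cite: TaoTrudgianYang2025, Definition 27] -/
theorem LargeValueBound.mono {σ τ ρ ρ' : ℝ} (h : LargeValueBound σ τ ρ) (hρ : ρ ≤ ρ') :
    LargeValueBound σ τ ρ' := by
  intro ε hε
  obtain ⟨C, δ, hδ, hC⟩ := h ε hε
  refine ⟨max C 1, δ, hδ, fun N T V a W hN hT₁ hT₂ hV₁ hV₂ ha hW hsep hla ↦ ?_⟩
  have hN1 : (1 : ℝ) ≤ N := (le_max_right C 1).trans hN
  calc (W.card : ℝ) ≤ C * (N : ℝ) ^ (ρ + ε) :=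
        hC N T V a W ((le_max_left _ _).trans hN) hT₁ hT₂ hV₁ hV₂ ha hW hsep hla
    _ ≤ max C 1 * (N : ℝ) ^ (ρ + ε) := mul_le_mul_of_nonneg_right (le_max_left _ _) (by positivity)
    _ ≤ max C 1 * (N : ℝ) ^ (ρ' + ε) :=
        mul_le_mul_of_nonneg_left (Real.rpow_le_rpow_of_exponent_le hN1 (by linarith))
          (by positivity)

/-- Shrinking the window `δ` (and enlarging `C`) in `LargeValueBound`: for every `ε > 0` and every
`δ₀ > 0` there are `C ≥ 1` and `0 < δ ≤ δ₀` with the defining property; private plumbing. [folklore] -/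
private theorem LargeValueBound.exists_le {σ τ ρ : ℝ} (h : LargeValueBound σ τ ρ) {ε δ₀ : ℝ} (hε : 0 < ε)
    (hδ₀ : 0 < δ₀) : ∃ C δ : ℝ, 1 ≤ C ∧ 0 < δ ∧ δ ≤ δ₀ ∧
    ∀ (N : ℕ) (T V : ℝ) (a : ℕ → ℂ) (W : Finset ℝ),
      C ≤ (N : ℝ) → (N : ℝ) ^ (τ - δ) ≤ T → T ≤ (N : ℝ) ^ (τ + δ) →
      (N : ℝ) ^ (σ - δ) ≤ V → V ≤ (N : ℝ) ^ (σ + δ) →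
      (∀ n, ‖a n‖ ≤ 1) → (∀ t ∈ W, 0 ≤ t ∧ t ≤ T) →
      (∀ t ∈ W, ∀ t' ∈ W, t ≠ t' → 1 ≤ |t - t'|) →
      (∀ t ∈ W, V ≤ ‖∑ n ∈ Finset.Icc N (2 * N), a n * (n : ℂ) ^ ((t : ℂ) * I)‖) →
      (W.card : ℝ) ≤ C * (N : ℝ) ^ (ρ + ε) := by
  obtain ⟨C, δ, hδ, hC⟩ := h ε hε
  refine ⟨max C 1, min δ δ₀, le_max_right _ _, lt_min hδ hδ₀, min_le_right _ _,
    fun N T V a W hN hT₁ hT₂ hV₁ hV₂ ha hW hsep hla ↦ ?_⟩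
  have hN1 : (1 : ℝ) ≤ N := (le_max_right C 1).trans hN
  have hT₁' : (N : ℝ) ^ (τ - δ) ≤ T :=
    (Real.rpow_le_rpow_of_exponent_le hN1 (by linarith [min_le_left δ δ₀])).trans hT₁
  have hT₂' : T ≤ (N : ℝ) ^ (τ + δ) :=
    hT₂.trans (Real.rpow_le_rpow_of_exponent_le hN1 (by linarith [min_le_left δ δ₀]))
  have hV₁' : (N : ℝ) ^ (σ - δ) ≤ V :=
    (Real.rpow_le_rpow_of_exponent_le hN1 (by linarith [min_le_left δ δ₀])).trans hV₁
  have hV₂' : V ≤ (N : ℝ) ^ (σ + δ) :=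
    hV₂.trans (Real.rpow_le_rpow_of_exponent_le hN1 (by linarith [min_le_left δ δ₀]))
  calc (W.card : ℝ) ≤ C * (N : ℝ) ^ (ρ + ε) :=
        hC N T V a W ((le_max_left _ _).trans hN) hT₁' hT₂' hV₁' hV₂' ha hW hsep hla
    _ ≤ max C 1 * (N : ℝ) ^ (ρ + ε) := mul_le_mul_of_nonneg_right (le_max_left _ _) (by positivity)

/-! ## Jutila's large values theorem in the tree's zero-detection shape and in `LV`-language -/

/-- Negative real powers of `V/(4N)`: `(V/(4N))^{−r} = 4^r N^r V^{−r}` (`V, N > 0`); plumbing.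
[folklore] -/
private lemma div_four_mul_rpow_neg {V N : ℝ} (r : ℝ) (hV : 0 < V) (hN : 0 < N) :
    (V / (4 * N)) ^ (-r) = (4 : ℝ) ^ r * N ^ r * V ^ (-r) := by
  rw [Real.rpow_neg (by positivity), Real.div_rpow hV.le (by positivity),
    Real.mul_rpow (by norm_num) hN.le, Real.rpow_neg hV.le]
  field_simp

/-- **Jutila's large values theorem in the tree's zero-detection shape.** For every `k ≥ 1` and
`ε > 0` there is `C` such that for all `N ≥ 1`, `T ≥ 1`, `V ≥ 2`, `1`-bounded `b`, and every finite
`1`-separated `W ⊂ [0, T]` with `|∑_{N ≤ n ≤ 2N} b_n n^{it}| ≥ V` on `W`,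
`#W ≤ C (NT)^ε (N² V^{−2} + T N^{4−2/k} V^{−(6−2/k)} + T N^{6k} V^{−8k})`. PROVED from the tree
theorem `Jutila1977_largeValues_holds` (Jutila 1977 (1.4) in Teräväinen's finite form, line
`Re s = 1`): apply it to `a_n = b_n · n/(2N)` on `N ≤ n < 2N`, the points `−t ∈ [−T, T]` and the
level `V/(4N) ≤ (2N)⁻¹ (V − 1)` (the dropped end point `n = 2N` costs `≤ 1 ≤ V/2`), and expand
`(V/(4N))^{−2} = 16 N² V^{−2}`, `(T/N²)(V/(4N))^{−6+2/k} = 4^{6−2/k} T N^{4−2/k} V^{−(6−2/k)}`,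
`(V/(4N))^{−8k} T/N^{2k} = 4^{8k} T N^{6k} V^{−8k}`. With `V = N^σ`, `T = N^τ` the three terms are
`N^{2−2σ}`, `N^{τ+(4−2/k)−(6−2/k)σ}`, `N^{τ+(6−8σ)k}` — Tao–Trudgian–Yang's `(jutila-lvt)`.
[cite: Jutila1977, Theorem, (1.4), p. 56] [cite: TaoTrudgianYang2025, item (iii) after Theorem 31, display (jutila-lvt)] -/
theorem jutila_largeValues_shape (k : ℕ) (hk : 1 ≤ k) (ε : ℝ) (hε : 0 < ε) :
    ∃ C : ℝ, 0 ≤ C ∧ ∀ (N : ℕ) (T V : ℝ) (b : ℕ → ℂ) (W : Finset ℝ),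
      1 ≤ N → 1 ≤ T → 2 ≤ V → (∀ n, ‖b n‖ ≤ 1) → (∀ t ∈ W, 0 ≤ t ∧ t ≤ T) →
      (∀ t ∈ W, ∀ t' ∈ W, t ≠ t' → 1 ≤ |t - t'|) →
      (∀ t ∈ W, V ≤ ‖∑ n ∈ Finset.Icc N (2 * N), b n * (n : ℂ) ^ ((t : ℂ) * I)‖) →
      (W.card : ℝ) ≤ C * ((N : ℝ) * T) ^ ε *
        ((N : ℝ) ^ (2 : ℝ) * V ^ (-2 : ℝ) +
          T * (N : ℝ) ^ (4 - 2 / k : ℝ) * V ^ (-(6 - 2 / k) : ℝ) +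
          T * (N : ℝ) ^ (6 * k : ℝ) * V ^ (-(8 * k) : ℝ)) := by
  obtain ⟨C, hC⟩ := Jutila1977_largeValues_holds k hk ε hε
  refine ⟨max C 0 * 4 ^ (8 * k), by positivity,
    fun N T V b W hNnat hT1 hV2 hb hW hsep hlarge ↦ ?_⟩
  classical
  have hkpos : 0 < k := hk
  have hk1 : (1 : ℝ) ≤ k := by exact_mod_cast hk
  have hT0 : (0 : ℝ) < T := by linarith
  have hN1 : (1 : ℝ) ≤ N := by exact_mod_cast hNnat
  have hN0 : (0 : ℝ) < N := by linarith
  have hNpos : 0 < N := hNnat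
  have hV0 : 0 < V := by linarith
  -- the data fed to Jutila's theorem
  set VJ : ℝ := V / (4 * N) with hVJdef
  have hVJ0 : 0 < VJ := by positivity
  set a : ℕ → ℂ := fun n ↦ if n < 2 * N then b n * ((n : ℂ) / (2 * N)) else 0 with hadef
  have ha : ∀ n, ‖a n‖ ≤ 1 := by
    intro n
    simp only [hadef]
    split_ifs with hn
    · rw [norm_mul, norm_div, Complex.norm_natCast]
      have h2N : ‖(2 * N : ℂ)‖ = 2 * N := by
        rw [norm_mul, Complex.norm_natCast, Complex.norm_two]
      rw [h2N]
      have hn' : (n : ℝ) ≤ 2 * N := by exact_mod_cast hn.le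
      have hq : (n : ℝ) / (2 * N) ≤ 1 := by
        rw [div_le_one (by positivity)]; exact hn'
      calc ‖b n‖ * ((n : ℝ) / (2 * N)) ≤ 1 * 1 :=
            mul_le_mul (hb n) hq (by positivity) zero_le_one
        _ = 1 := one_mul 1
    · simp
  set W' : Finset ℝ := W.image (fun t : ℝ ↦ -t) with hW'def
  have hinj : Function.Injective (fun t : ℝ ↦ -t) := neg_injective
  have hcard : W'.card = W.card := Finset.card_image_of_injective _ hinj
  have hW' : ∀ t ∈ W', -T ≤ t ∧ t ≤ T := by
    intro t ht
    rw [hW'def, Finset.mem_image] at ht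
    obtain ⟨u, hu, rfl⟩ := ht
    have := hW u hu
    constructor <;> linarith
  have hsep' : ∀ t ∈ W', ∀ t' ∈ W', t ≠ t' → 1 ≤ |t - t'| := by
    intro t ht t' ht' hne
    rw [hW'def, Finset.mem_image] at ht ht'
    obtain ⟨u, hu, rfl⟩ := ht
    obtain ⟨u', hu', rfl⟩ := ht'
    have hne' : u ≠ u' := fun h ↦ hne (by rw [h])
    have := hsep u hu u' hu' hne'
    rwa [show -u - -u' = -(u - u') by ring, abs_neg]
  -- the normalised polynomial at `1 + i(−t)` is `(2N)⁻¹ ∑_{N ≤ n < 2N} b_n n^{it}`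
  have hterm : ∀ t : ℝ, ∀ n ∈ Finset.Ico N (2 * N),
      a n * (n : ℂ) ^ (-(1 + ((-t : ℝ) : ℂ) * I)) = (2 * N : ℂ)⁻¹ * (b n * (n : ℂ) ^ ((t : ℂ) * I)) := by
    intro t n hn
    rw [Finset.mem_Ico] at hn
    have hn0 : (n : ℂ) ≠ 0 := by
      have : 0 < n := lt_of_lt_of_le hNpos hn.1
      exact_mod_cast this.ne'
    have h2N0 : (2 * N : ℂ) ≠ 0 := by
      have : (0 : ℝ) < 2 * N := by positivity
      exact_mod_cast this.ne'
    simp only [hadef, if_pos hn.2]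
    rw [show -(1 + ((-t : ℝ) : ℂ) * I) = (-1 : ℂ) + (t : ℂ) * I by push_cast; ring,
      Complex.cpow_add _ _ hn0, Complex.cpow_neg_one]
    field_simp
  have hsumeq : ∀ t : ℝ, ∑ n ∈ Finset.Ico N (2 * N), a n * (n : ℂ) ^ (-(1 + ((-t : ℝ) : ℂ) * I)) =
      (2 * N : ℂ)⁻¹ * ∑ n ∈ Finset.Ico N (2 * N), b n * (n : ℂ) ^ ((t : ℂ) * I) := by
    intro t
    rw [Finset.mul_sum]
    exact Finset.sum_congr rfl (hterm t)
  -- dropping the end point `n = 2N` costs at most `1`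
  have hIco : ∀ t ∈ W, V - 1 ≤ ‖∑ n ∈ Finset.Ico N (2 * N), b n * (n : ℂ) ^ ((t : ℂ) * I)‖ := by
    intro t ht
    have hsplit : ∑ n ∈ Finset.Icc N (2 * N), b n * (n : ℂ) ^ ((t : ℂ) * I) =
        b (2 * N) * ((2 * N : ℕ) : ℂ) ^ ((t : ℂ) * I) +
          ∑ n ∈ Finset.Ico N (2 * N), b n * (n : ℂ) ^ ((t : ℂ) * I) := by
      rw [← Finset.Ico_insert_right (by omega : N ≤ 2 * N), Finset.sum_insert Finset.right_notMem_Ico]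
    have hlast : ‖b (2 * N) * ((2 * N : ℕ) : ℂ) ^ ((t : ℂ) * I)‖ ≤ 1 := by
      rw [norm_mul, Complex.norm_natCast_cpow_of_pos (by omega)]
      simp only [Complex.mul_re, Complex.ofReal_re, Complex.I_re, Complex.ofReal_im, Complex.I_im,
        mul_zero, mul_one, sub_self, Real.rpow_zero]
      simpa using hb (2 * N)
    have h1 := hlarge t ht
    rw [hsplit] at h1
    have h2 := norm_add_le (b (2 * N) * ((2 * N : ℕ) : ℂ) ^ ((t : ℂ) * I))
      (∑ n ∈ Finset.Ico N (2 * N), b n * (n : ℂ) ^ ((t : ℂ) * I))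
    linarith
  have hlarge' : ∀ t ∈ W', VJ ≤ ‖∑ n ∈ Finset.Ico N (2 * N), a n * (n : ℂ) ^ (-(1 + (t : ℂ) * I))‖ := by
    intro t ht
    rw [hW'def, Finset.mem_image] at ht
    obtain ⟨u, hu, rfl⟩ := ht
    rw [hsumeq u, norm_mul, norm_inv]
    have h2N : ‖(2 * N : ℂ)‖ = 2 * N := by
      rw [norm_mul, Complex.norm_natCast, Complex.norm_two]
    rw [h2N]
    have h1 := hIco u hu
    have hV' : VJ = (2 * (N : ℝ))⁻¹ * (V / 2) := by
      rw [hVJdef]; field_simp; ring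
    rw [hV']
    exact mul_le_mul_of_nonneg_left (by linarith) (by positivity)
  -- Jutila's theorem
  have hR := hC N T VJ a W' hNnat hT1 hVJ0 ha hW' hsep' hlarge'
  rw [hcard] at hR
  have hS0 : 0 ≤ VJ ^ (-2 : ℝ) + T / (N : ℝ) ^ 2 * VJ ^ (-6 + 2 / k : ℝ) +
      VJ ^ (-(8 * k : ℝ)) * T / (N : ℝ) ^ (2 * k) := by
    positivity
  -- simplify the three terms
  have e1 : VJ ^ (-2 : ℝ) = (4 : ℝ) ^ (2 : ℝ) * ((N : ℝ) ^ (2 : ℝ) * V ^ (-2 : ℝ)) := by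
    rw [hVJdef, div_four_mul_rpow_neg 2 hV0 hN0]; ring
  have e2 : T / (N : ℝ) ^ 2 * VJ ^ (-6 + 2 / k : ℝ) =
      (4 : ℝ) ^ (6 - 2 / k : ℝ) * (T * (N : ℝ) ^ (4 - 2 / k : ℝ) * V ^ (-(6 - 2 / k) : ℝ)) := by
    rw [show (-6 + 2 / k : ℝ) = -(6 - 2 / k) by ring, hVJdef, div_four_mul_rpow_neg (6 - 2 / k) hV0 hN0]
    have : (N : ℝ) ^ (4 - 2 / k : ℝ) = (N : ℝ) ^ (6 - 2 / k : ℝ) / (N : ℝ) ^ 2 := by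
      rw [← Real.rpow_two, ← Real.rpow_sub hN0]; congr 1; ring
    rw [this]; field_simp
  have e3 : VJ ^ (-(8 * k : ℝ)) * T / (N : ℝ) ^ (2 * k) =
      (4 : ℝ) ^ (8 * k : ℝ) * (T * (N : ℝ) ^ (6 * k : ℝ) * V ^ (-(8 * k) : ℝ)) := by
    rw [hVJdef, div_four_mul_rpow_neg (8 * k) hV0 hN0]
    have : (N : ℝ) ^ (6 * k : ℝ) = (N : ℝ) ^ (8 * k : ℝ) / (N : ℝ) ^ (2 * k) := by
      rw [show ((N : ℝ) ^ (2 * k) : ℝ) = (N : ℝ) ^ (((2 * k : ℕ) : ℝ)) from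
          (Real.rpow_natCast _ (2 * k)).symm, ← Real.rpow_sub hN0]
      congr 1; push_cast; ring
    rw [this]; field_simp
  -- numerical constants `4^r ≤ 4^{8k}`
  have c8k : (4 : ℝ) ^ (8 * k : ℝ) = (4 : ℝ) ^ (8 * k) := by
    rw [show (8 * k : ℝ) = ((8 * k : ℕ) : ℝ) by push_cast; ring, Real.rpow_natCast]
  have hk8 : (8 : ℝ) ≤ 8 * k := by nlinarith
  have c1 : (4 : ℝ) ^ (2 : ℝ) ≤ (4 : ℝ) ^ (8 * k) := by
    rw [← c8k]; exact Real.rpow_le_rpow_of_exponent_le (by norm_num) (by linarith)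
  have c2 : (4 : ℝ) ^ (6 - 2 / k : ℝ) ≤ (4 : ℝ) ^ (8 * k) := by
    rw [← c8k]
    refine Real.rpow_le_rpow_of_exponent_le (by norm_num) ?_
    have : (0 : ℝ) ≤ 2 / k := by positivity
    linarith
  -- assemble
  have hX0 : 0 ≤ (N : ℝ) ^ (2 : ℝ) * V ^ (-2 : ℝ) := by positivity
  have hY0 : 0 ≤ T * (N : ℝ) ^ (4 - 2 / k : ℝ) * V ^ (-(6 - 2 / k) : ℝ) := by positivity
  have hZ0 : 0 ≤ T * (N : ℝ) ^ (6 * k : ℝ) * V ^ (-(8 * k) : ℝ) := by positivity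
  have hsum : VJ ^ (-2 : ℝ) + T / (N : ℝ) ^ 2 * VJ ^ (-6 + 2 / k : ℝ) +
      VJ ^ (-(8 * k : ℝ)) * T / (N : ℝ) ^ (2 * k) ≤
      (4 : ℝ) ^ (8 * k) * ((N : ℝ) ^ (2 : ℝ) * V ^ (-2 : ℝ) +
          T * (N : ℝ) ^ (4 - 2 / k : ℝ) * V ^ (-(6 - 2 / k) : ℝ) +
          T * (N : ℝ) ^ (6 * k : ℝ) * V ^ (-(8 * k) : ℝ)) := by
    rw [e1, e2, e3, c8k]
    nlinarith [mul_le_mul_of_nonneg_right c1 hX0, mul_le_mul_of_nonneg_right c2 hY0]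
  have hM0 : 0 ≤ max C 0 := le_max_right _ _
  have hG0 : 0 ≤ (N : ℝ) ^ (2 : ℝ) * V ^ (-2 : ℝ) +
      T * (N : ℝ) ^ (4 - 2 / k : ℝ) * V ^ (-(6 - 2 / k) : ℝ) +
      T * (N : ℝ) ^ (6 * k : ℝ) * V ^ (-(8 * k) : ℝ) := by positivity
  have hNT0 : 0 ≤ ((N : ℝ) * T) ^ ε := by positivity
  calc (W.card : ℝ) ≤ C * ((N : ℝ) * T) ^ ε *
        (VJ ^ (-2 : ℝ) + T / (N : ℝ) ^ 2 * VJ ^ (-6 + 2 / k : ℝ) +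
          VJ ^ (-(8 * k : ℝ)) * T / (N : ℝ) ^ (2 * k)) := hR
    _ ≤ max C 0 * ((N : ℝ) * T) ^ ε *
        (VJ ^ (-2 : ℝ) + T / (N : ℝ) ^ 2 * VJ ^ (-6 + 2 / k : ℝ) +
          VJ ^ (-(8 * k : ℝ)) * T / (N : ℝ) ^ (2 * k)) :=
        mul_le_mul_of_nonneg_right (mul_le_mul_of_nonneg_right (le_max_left _ _) hNT0) hS0
    _ ≤ max C 0 * ((N : ℝ) * T) ^ ε * ((4 : ℝ) ^ (8 * k) * ((N : ℝ) ^ (2 : ℝ) * V ^ (-2 : ℝ) +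
          T * (N : ℝ) ^ (4 - 2 / k : ℝ) * V ^ (-(6 - 2 / k) : ℝ) +
          T * (N : ℝ) ^ (6 * k : ℝ) * V ^ (-(8 * k) : ℝ))) :=
        mul_le_mul_of_nonneg_left hsum (by positivity)
    _ = max C 0 * 4 ^ (8 * k) * ((N : ℝ) * T) ^ ε * ((N : ℝ) ^ (2 : ℝ) * V ^ (-2 : ℝ) +
          T * (N : ℝ) ^ (4 - 2 / k : ℝ) * V ^ (-(6 - 2 / k) : ℝ) +
          T * (N : ℝ) ^ (6 * k : ℝ) * V ^ (-(8 * k) : ℝ)) := by ring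


/-- From a lower bound `N^x ≤ V` to an upper bound for a negative power: `V^{−r} ≤ N^{−xr}`
(`N > 0`, `r ≥ 0`); plumbing. [folklore] -/
private lemma rpow_neg_le_of_rpow_le {N V x r : ℝ} (hN : 0 < N) (hV : N ^ x ≤ V) (hr : 0 ≤ r) :
    V ^ (-r) ≤ N ^ (-(x * r)) := by
  have hNx : 0 < N ^ x := Real.rpow_pos_of_pos hN x
  calc V ^ (-r) ≤ (N ^ x) ^ (-r) := Real.rpow_le_rpow_of_nonpos hNx hV (by linarith)
    _ = N ^ (-(x * r)) := by rw [← Real.rpow_mul hN.le]; ring_nf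

/-- One monomial of a large values bound in powers of `N`: `T ≤ N^{τ+δ}`, `V ≥ N^{σ−δ}` give
`T N^e V^{−r} ≤ N^{τ+δ+e−(σ−δ)r}` (`r ≥ 0`); plumbing. [folklore] -/
private lemma monomial_le_rpow {N T V τ δ σ e r : ℝ} (hN : 1 ≤ N)
    (hT : T ≤ N ^ (τ + δ)) (hV0 : 0 < V) (hV : N ^ (σ - δ) ≤ V) (hr : 0 ≤ r) :
    T * N ^ e * V ^ (-r) ≤ N ^ (τ + δ + e - (σ - δ) * r) := by
  have hN0 : 0 < N := by linarith
  have h1 : V ^ (-r) ≤ N ^ (-((σ - δ) * r)) := rpow_neg_le_of_rpow_le hN0 hV hr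
  have h2 : 0 ≤ V ^ (-r) := Real.rpow_nonneg hV0.le _
  calc T * N ^ e * V ^ (-r) ≤ N ^ (τ + δ) * N ^ e * N ^ (-((σ - δ) * r)) := by gcongr
    _ = N ^ (τ + δ + e - (σ - δ) * r) := by
        rw [← Real.rpow_add hN0, ← Real.rpow_add hN0]; ring_nf

/-- **Jutila's large values theorem as the bound
`LV(σ, τ) ≤ max(2 − 2σ, τ + (4 − 2/k) − (6 − 2/k)σ, τ + (6 − 8σ)k)`** for every `k ≥ 1`,
`σ ≥ 1/2`, `τ > 0` (Tao–Trudgian–Yang, `(jutila-lvt)`: "`LV(σ,τ) ≤ max(2−2σ, τ+(4−2/k)−(6−2/k)σ, τ+(6−8σ)k)`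
for any positive integer `k`"), PROVED: `jutila_largeValues_shape` with `ε/(2(2+τ))`, the window
`δ = min(τ/2, 1/4, ε/(2(8k+1)))`, and monomial bookkeeping (`T ≤ N^{τ+δ}`, `V ≥ N^{σ−δ} ≥ N^{1/4} ≥ 2`
for `N ≥ 16`). [cite: TaoTrudgianYang2025, display (jutila-lvt) after Theorem 31] [cite: Jutila1977, Theorem, (1.4), p. 56] -/
theorem largeValueBound_jutila {σ τ : ℝ} (k : ℕ) (hk : 1 ≤ k) (hσ : 1 / 2 ≤ σ) (hτ : 0 < τ) :
    LargeValueBound σ τ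
      (max (2 - 2 * σ) (max (τ + (4 - 2 / k) - (6 - 2 / k) * σ) (τ + (6 - 8 * σ) * k))) := by
  intro ε hε
  obtain ⟨M, hM⟩ : ∃ M : ℝ,
      max (2 - 2 * σ) (max (τ + (4 - 2 / k) - (6 - 2 / k) * σ) (τ + (6 - 8 * σ) * k)) = M :=
    ⟨_, rfl⟩
  have hM1 : 2 - 2 * σ ≤ M := by rw [← hM]; exact le_max_left _ _
  have hM2 : τ + (4 - 2 / k) - (6 - 2 / k) * σ ≤ M := by
    rw [← hM]; exact (le_max_left _ _).trans (le_max_right _ _)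
  have hM3 : τ + (6 - 8 * σ) * k ≤ M := by
    rw [← hM]; exact (le_max_right _ _).trans (le_max_right _ _)
  rw [hM]
  have hk1 : (1 : ℝ) ≤ k := by exact_mod_cast hk
  have hk0 : (0 : ℝ) < k := by linarith
  obtain ⟨C, hC0, hC⟩ := jutila_largeValues_shape k hk (ε / (2 * (2 + τ))) (by positivity)
  obtain ⟨δ, hδ⟩ : ∃ δ : ℝ, min (τ / 2) (min (1 / 4) (ε / (2 * (8 * k + 1)))) = δ := ⟨_, rfl⟩
  have hδ0 : 0 < δ := by rw [← hδ]; positivity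
  have hδτ : δ ≤ τ / 2 := by rw [← hδ]; exact min_le_left _ _
  have hδ4 : δ ≤ 1 / 4 := by rw [← hδ]; exact (min_le_right _ _).trans (min_le_left _ _)
  have hδε : δ ≤ ε / (2 * (8 * k + 1)) := by
    rw [← hδ]; exact (min_le_right _ _).trans (min_le_right _ _)
  have hδε' : δ * (8 * k + 1) ≤ ε / 2 := by
    rw [le_div_iff₀ (by positivity)] at hδε
    linarith
  refine ⟨max 16 (3 * C), δ, hδ0, fun N T V a W hN hT₁ hT₂ hV₁ hV₂ ha hW hsep hla ↦ ?_⟩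
  have hN16 : (16 : ℝ) ≤ N := (le_max_left _ _).trans hN
  have hN1 : (1 : ℝ) ≤ N := by linarith
  have hN0 : (0 : ℝ) < N := by linarith
  have hNnat : 1 ≤ N := by exact_mod_cast hN1
  have hT1 : 1 ≤ T := (Real.one_le_rpow hN1 (by linarith)).trans hT₁
  have hT0 : 0 ≤ T := by linarith
  have hV2 : 2 ≤ V := by
    have h1 : (N : ℝ) ^ (1 / 4 : ℝ) ≤ (N : ℝ) ^ (σ - δ) :=
      Real.rpow_le_rpow_of_exponent_le hN1 (by linarith)
    have h2 : (16 : ℝ) ^ (1 / 4 : ℝ) ≤ (N : ℝ) ^ (1 / 4 : ℝ) :=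
      Real.rpow_le_rpow (by norm_num) hN16 (by norm_num)
    have h3 : (16 : ℝ) ^ (1 / 4 : ℝ) = 2 := by
      rw [show (16 : ℝ) = 2 ^ (4 : ℝ) by norm_num, ← Real.rpow_mul (by norm_num)]; norm_num
    linarith
  have hV0 : 0 < V := by linarith
  have hR := hC N T V a W hNnat hT1 hV2 ha hW hsep hla
  -- `(NT)^{ε/(2(2+τ))} ≤ N^{ε/2}`
  have hA : ((N : ℝ) * T) ^ (ε / (2 * (2 + τ))) ≤ (N : ℝ) ^ (ε / 2) := by
    have h1 : (N : ℝ) * T ≤ (N : ℝ) ^ (1 + (τ + δ)) := by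
      rw [Real.rpow_add hN0, Real.rpow_one]; exact mul_le_mul_of_nonneg_left hT₂ hN0.le
    have h2 : (1 + (τ + δ)) * (ε / (2 * (2 + τ))) ≤ ε / 2 := by
      have h3 : (1 + (τ + δ)) / (2 + τ) ≤ 1 := by rw [div_le_one (by positivity)]; linarith
      calc (1 + (τ + δ)) * (ε / (2 * (2 + τ))) = ε / 2 * ((1 + (τ + δ)) / (2 + τ)) := by
            field_simp
        _ ≤ ε / 2 * 1 := mul_le_mul_of_nonneg_left h3 (by positivity)
        _ = ε / 2 := mul_one _
    calc ((N : ℝ) * T) ^ (ε / (2 * (2 + τ))) ≤ ((N : ℝ) ^ (1 + (τ + δ))) ^ (ε / (2 * (2 + τ))) :=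
          Real.rpow_le_rpow (by positivity) h1 (by positivity)
      _ = (N : ℝ) ^ ((1 + (τ + δ)) * (ε / (2 * (2 + τ)))) := by rw [← Real.rpow_mul hN0.le]
      _ ≤ (N : ℝ) ^ (ε / 2) := Real.rpow_le_rpow_of_exponent_le hN1 h2
  -- the three monomials
  have h2k : (0 : ℝ) ≤ 2 / k := by positivity
  have h2k' : 2 / (k : ℝ) ≤ 2 := by
    rw [div_le_iff₀ hk0]; linarith
  have hdk1 : δ ≤ δ * k := by nlinarith
  have hσk : 0 ≤ σ * (2 / k) := by positivity
  have hδk2 : 0 ≤ δ * (2 / k) := by positivity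
  have ex1 : 2 - 2 * σ + 2 * δ ≤ M + ε / 2 := by linarith
  have ex2 : τ + δ + (4 - 2 / k) - (σ - δ) * (6 - 2 / k) ≤ M + ε / 2 := by
    have e : τ + δ + (4 - 2 / k) - (σ - δ) * (6 - 2 / k) =
        (τ + (4 - 2 / k) - (6 - 2 / k) * σ) + (7 * δ - δ * (2 / k)) := by ring
    rw [e]; linarith
  have ex3 : τ + δ + 6 * k - (σ - δ) * (8 * k) ≤ M + ε / 2 := by
    have e : τ + δ + 6 * k - (σ - δ) * (8 * k) = (τ + (6 - 8 * σ) * k) + δ * (8 * k + 1) := by ring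
    rw [e]; linarith
  have t1 : (N : ℝ) ^ (2 : ℝ) * V ^ (-2 : ℝ) ≤ (N : ℝ) ^ (M + ε / 2) := by
    have h1 : V ^ (-(2 : ℝ)) ≤ (N : ℝ) ^ (-((σ - δ) * 2)) := rpow_neg_le_of_rpow_le hN0 hV₁ (by norm_num)
    calc (N : ℝ) ^ (2 : ℝ) * V ^ (-2 : ℝ) ≤ (N : ℝ) ^ (2 : ℝ) * (N : ℝ) ^ (-((σ - δ) * 2)) :=
          mul_le_mul_of_nonneg_left h1 (by positivity)
      _ = (N : ℝ) ^ (2 - 2 * σ + 2 * δ) := by rw [← Real.rpow_add hN0]; ring_nf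
      _ ≤ (N : ℝ) ^ (M + ε / 2) := Real.rpow_le_rpow_of_exponent_le hN1 ex1
  have t2 : T * (N : ℝ) ^ (4 - 2 / k : ℝ) * V ^ (-(6 - 2 / k) : ℝ) ≤ (N : ℝ) ^ (M + ε / 2) :=
    (monomial_le_rpow hN1 hT₂ hV0 hV₁ (by linarith)).trans
      (Real.rpow_le_rpow_of_exponent_le hN1 ex2)
  have t3 : T * (N : ℝ) ^ (6 * k : ℝ) * V ^ (-(8 * k) : ℝ) ≤ (N : ℝ) ^ (M + ε / 2) :=
    (monomial_le_rpow hN1 hT₂ hV0 hV₁ (by positivity)).trans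
      (Real.rpow_le_rpow_of_exponent_le hN1 ex3)
  -- assemble
  have hsum : (N : ℝ) ^ (2 : ℝ) * V ^ (-2 : ℝ) + T * (N : ℝ) ^ (4 - 2 / k : ℝ) * V ^ (-(6 - 2 / k) : ℝ) +
      T * (N : ℝ) ^ (6 * k : ℝ) * V ^ (-(8 * k) : ℝ) ≤ 3 * (N : ℝ) ^ (M + ε / 2) := by
    have h := add_le_add (add_le_add t1 t2) t3
    have h3 : (N : ℝ) ^ (M + ε / 2) + (N : ℝ) ^ (M + ε / 2) + (N : ℝ) ^ (M + ε / 2) =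
        3 * (N : ℝ) ^ (M + ε / 2) := by ring
    exact h.trans h3.le
  have hNε : 0 ≤ (N : ℝ) ^ (ε / 2) := by positivity
  have step1 : (W.card : ℝ) ≤ C * ((N : ℝ) * T) ^ (ε / (2 * (2 + τ))) *
        ((N : ℝ) ^ (2 : ℝ) * V ^ (-2 : ℝ) + T * (N : ℝ) ^ (4 - 2 / k : ℝ) * V ^ (-(6 - 2 / k) : ℝ) +
          T * (N : ℝ) ^ (6 * k : ℝ) * V ^ (-(8 * k) : ℝ)) := hR
  have h0 : 0 ≤ (N : ℝ) ^ (2 : ℝ) * V ^ (-2 : ℝ) + T * (N : ℝ) ^ (4 - 2 / k : ℝ) *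
      V ^ (-(6 - 2 / k) : ℝ) + T * (N : ℝ) ^ (6 * k : ℝ) * V ^ (-(8 * k) : ℝ) := by positivity
  have h1 : C * ((N : ℝ) * T) ^ (ε / (2 * (2 + τ))) ≤ C * (N : ℝ) ^ (ε / 2) :=
    mul_le_mul_of_nonneg_left hA hC0
  have h2 : 0 ≤ C * (N : ℝ) ^ (ε / 2) := mul_nonneg hC0 hNε
  have step2 : C * ((N : ℝ) * T) ^ (ε / (2 * (2 + τ))) *
        ((N : ℝ) ^ (2 : ℝ) * V ^ (-2 : ℝ) + T * (N : ℝ) ^ (4 - 2 / k : ℝ) * V ^ (-(6 - 2 / k) : ℝ) +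
          T * (N : ℝ) ^ (6 * k : ℝ) * V ^ (-(8 * k) : ℝ)) ≤
        C * (N : ℝ) ^ (ε / 2) * (3 * (N : ℝ) ^ (M + ε / 2)) :=
    (mul_le_mul_of_nonneg_right h1 h0).trans (mul_le_mul_of_nonneg_left hsum h2)
  have step3 : C * (N : ℝ) ^ (ε / 2) * (3 * (N : ℝ) ^ (M + ε / 2)) = 3 * C * (N : ℝ) ^ (M + ε) := by
    have : (N : ℝ) ^ (M + ε) = (N : ℝ) ^ (ε / 2) * (N : ℝ) ^ (M + ε / 2) := by
      rw [← Real.rpow_add hN0]; ring_nf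
    rw [this]; ring
  have step4 : 3 * C * (N : ℝ) ^ (M + ε) ≤ max 16 (3 * C) * (N : ℝ) ^ (M + ε) :=
    mul_le_mul_of_nonneg_right (le_max_right _ _) (by positivity)
  exact step1.trans (step2.trans (step3.le.trans step4))


/-! ## From bounds `LV(σ, τ) ≤ κτ` on a `τ`-interval to the uniform window hypothesis, and zero density (TTY Cor. 42–43) -/

/-- `N^{log T / log N} = T` for `N > 1`, `T > 0`; plumbing. [folklore] -/
private lemma rpow_log_div_log {N T : ℝ} (hN : 1 < N) (hT : 0 < T) :
    N ^ (Real.log T / Real.log N) = T := by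
  have hlogN : Real.log N ≠ 0 := (Real.log_pos hN).ne'
  rw [Real.rpow_def_of_pos (by linarith), mul_div_cancel₀ _ hlogN, Real.exp_log hT]

/-- **Compactness in `τ`: pointwise large value bounds `LV(σ,τ) ≤ κτ` for `1 ≤ τ ≤ 1/α` give the
uniform window bound** — for every `ε > 0` there are `δ > 0`, `C`, `T₀` with `#W ≤ C T^{κ+ε}` for
all `T ≥ T₀`, `T^α ≤ N ≤ T`, `1`-bounded `b`, `1`-separated `W ⊂ [0,T]` carrying
`|∑_{N ≤ n ≤ 2N} b_n n^{it}| ≥ N^{σ−δ}` (the hypothesis shape of the tree's window zero detection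
`isBigO_zetaZeroCountRe_of_largeValuesOnWindow`). Proof: cover `[1, 1/α]` by the windows
`(τ − δ_τ, τ + δ_τ)` of the finitary definition (with `ε/2`, and `δ_τ ≤ ε/(2κ+2)`), extract a
finite subcover, take `C = max C_τ`, `δ = min δ_τ`, `T₀ = (max(2, C))^{1/α}`; for given `N, T` put
`τ* = log T / log N ∈ [1, 1/α]`, so `N^{τ*} = T` and `τ*` lies in some window, whence
`#W ≤ C_τ N^{κτ+ε/2} ≤ C_τ T^{κ} T^{κδ_τ + ε/2} ≤ C T^{κ+ε}`. (Tao–Trudgian–Yang pass between the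
asymptotic and non-asymptotic forms of Definition 27 in exactly this way: "As with previous
definitions, this exponent can be expressed non-asymptotically".) [cite: TaoTrudgianYang2025, Definition 27 and Lemma 28] -/
theorem largeValuesOnWindow_of_largeValueBound {σ α κ : ℝ} (hα : 0 < α) (hα1 : α ≤ 1)
    (hκ : 0 ≤ κ) (h : ∀ τ : ℝ, 1 ≤ τ → τ ≤ 1 / α → LargeValueBound σ τ (κ * τ)) :
    ∀ ε : ℝ, 0 < ε → ∃ δ C T₀ : ℝ, 0 < δ ∧ ∀ T : ℝ, T₀ ≤ T →
      ∀ (N : ℕ) (b : ℕ → ℂ) (W : Finset ℝ), T ^ α ≤ (N : ℝ) → (N : ℝ) ≤ T →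
      (∀ n, ‖b n‖ ≤ 1) → (∀ t ∈ W, 0 ≤ t ∧ t ≤ T) →
      (∀ t ∈ W, ∀ t' ∈ W, t ≠ t' → 1 ≤ |t - t'|) →
      (∀ t ∈ W, (N : ℝ) ^ (σ - δ) ≤ ‖∑ n ∈ Finset.Icc N (2 * N), b n * (n : ℂ) ^ ((t : ℂ) * I)‖) →
      (W.card : ℝ) ≤ C * T ^ (κ + ε) := by
  intro ε hε
  obtain ⟨S, hSdef⟩ : ∃ S : Set ℝ, S = Set.Icc 1 (1 / α) := ⟨_, rfl⟩
  have hS : IsCompact S := hSdef ▸ isCompact_Icc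
  have h1α : (1 : ℝ) ≤ 1 / α := by rw [le_div_iff₀ hα]; linarith
  have hdata : ∀ τ : S, ∃ C δ : ℝ, 1 ≤ C ∧ 0 < δ ∧ δ ≤ ε / (2 * κ + 2) ∧
      ∀ (N : ℕ) (T V : ℝ) (a : ℕ → ℂ) (W : Finset ℝ),
        C ≤ (N : ℝ) → (N : ℝ) ^ ((τ : ℝ) - δ) ≤ T → T ≤ (N : ℝ) ^ ((τ : ℝ) + δ) →
        (N : ℝ) ^ (σ - δ) ≤ V → V ≤ (N : ℝ) ^ (σ + δ) →
        (∀ n, ‖a n‖ ≤ 1) → (∀ t ∈ W, 0 ≤ t ∧ t ≤ T) →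
        (∀ t ∈ W, ∀ t' ∈ W, t ≠ t' → 1 ≤ |t - t'|) →
        (∀ t ∈ W, V ≤ ‖∑ n ∈ Finset.Icc N (2 * N), a n * (n : ℂ) ^ ((t : ℂ) * I)‖) →
        (W.card : ℝ) ≤ C * (N : ℝ) ^ (κ * τ + ε / 2) := by
    intro τ
    have hτS : (τ : ℝ) ∈ Set.Icc 1 (1 / α) := hSdef ▸ τ.2
    exact (h τ hτS.1 hτS.2).exists_le (half_pos hε) (by positivity)
  choose Cf δf hC1 hδ0 hδle hP using hdata
  -- a finite subcover of `[1, 1/α]` by the windows `(τ − δ_τ, τ + δ_τ)`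
  obtain ⟨F, hF⟩ := hS.elim_finite_subcover (fun τ : S ↦ Set.Ioo ((τ : ℝ) - δf τ) ((τ : ℝ) + δf τ))
    (fun _ ↦ isOpen_Ioo) (fun x hx ↦ Set.mem_iUnion.2 ⟨⟨x, hx⟩, by
      constructor <;> linarith [hδ0 ⟨x, hx⟩]⟩)
  have h1S : (1 : ℝ) ∈ S := hSdef ▸ ⟨le_rfl, h1α⟩
  have hFne : F.Nonempty := by
    obtain ⟨τ, hτ⟩ := Set.mem_iUnion.1 (hF h1S)
    obtain ⟨hτF, -⟩ := Set.mem_iUnion.1 hτ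
    exact ⟨τ, hτF⟩
  obtain ⟨C₀, hC₀def⟩ : ∃ C₀ : ℝ, F.sup' hFne Cf = C₀ := ⟨_, rfl⟩
  obtain ⟨δ₀, hδ₀def⟩ : ∃ δ₀ : ℝ, F.inf' hFne δf = δ₀ := ⟨_, rfl⟩
  have hδ₀ : 0 < δ₀ := by
    rw [← hδ₀def]; exact (Finset.lt_inf'_iff hFne).2 fun τ _ ↦ hδ0 τ
  have hδ₀le : ∀ τ ∈ F, δ₀ ≤ δf τ := fun τ hτ ↦ hδ₀def ▸ Finset.inf'_le _ hτ
  have hCle : ∀ τ ∈ F, Cf τ ≤ C₀ := fun τ hτ ↦ hC₀def ▸ Finset.le_sup' Cf hτ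
  have hC₀1 : 1 ≤ C₀ := by
    obtain ⟨τ, hτ⟩ := hFne
    exact (hC1 τ).trans (hCle τ hτ)
  refine ⟨δ₀, C₀, (max 2 C₀) ^ (1 / α), hδ₀, fun T hT N b W hN1 hN2 hb hW hsep hla ↦ ?_⟩
  have hM2 : (2 : ℝ) ≤ max 2 C₀ := le_max_left _ _
  have hM0 : (0 : ℝ) ≤ max 2 C₀ := by linarith
  have hT₀1 : (1 : ℝ) ≤ (max 2 C₀) ^ (1 / α) := Real.one_le_rpow (by linarith) (by positivity)
  have hT1 : 1 ≤ T := hT₀1.trans hT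
  have hT0 : 0 < T := by linarith
  -- `N ≥ T^α ≥ max(2, C₀)`
  have hNbig : max 2 C₀ ≤ (N : ℝ) := by
    have h1 : ((max 2 C₀) ^ (1 / α)) ^ α ≤ T ^ α := Real.rpow_le_rpow (by positivity) hT hα.le
    rw [← Real.rpow_mul hM0, one_div_mul_cancel hα.ne', Real.rpow_one] at h1
    exact h1.trans hN1
  have hN2' : (2 : ℝ) ≤ N := hM2.trans hNbig
  have hN1' : (1 : ℝ) < N := by linarith
  have hN0 : (0 : ℝ) < N := by linarith
  -- the exponent `τ* = log T / log N ∈ [1, 1/α]` with `N^{τ*} = T`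
  have hlogN : 0 < Real.log N := Real.log_pos hN1'
  obtain ⟨τs, hτs⟩ : ∃ τs : ℝ, Real.log T / Real.log N = τs := ⟨_, rfl⟩
  have hNτs : (N : ℝ) ^ τs = T := hτs ▸ rpow_log_div_log hN1' hT0
  have hτs1 : 1 ≤ τs := by
    rw [← hτs, one_le_div hlogN]; exact Real.log_le_log hN0 hN2
  have hτs2 : τs ≤ 1 / α := by
    rw [← hτs, div_le_iff₀ hlogN, one_div_mul_eq_div, le_div_iff₀ hα]
    have : Real.log (T ^ α) ≤ Real.log N := Real.log_le_log (Real.rpow_pos_of_pos hT0 α) hN1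
    rwa [Real.log_rpow hT0, mul_comm] at this
  have hτsS : τs ∈ S := hSdef ▸ ⟨hτs1, hτs2⟩
  obtain ⟨τ, hτ⟩ := Set.mem_iUnion.1 (hF hτsS)
  obtain ⟨hτF, hτU⟩ := Set.mem_iUnion.1 hτ
  rw [Set.mem_Ioo] at hτU
  -- apply the finitary bound at `τ`
  have hNC : Cf τ ≤ (N : ℝ) := (hCle τ hτF).trans ((le_max_right _ _).trans hNbig)
  have hTlo : (N : ℝ) ^ ((τ : ℝ) - δf τ) ≤ T := by
    rw [← hNτs]; exact Real.rpow_le_rpow_of_exponent_le hN1'.le (by linarith)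
  have hThi : T ≤ (N : ℝ) ^ ((τ : ℝ) + δf τ) := by
    rw [← hNτs]; exact Real.rpow_le_rpow_of_exponent_le hN1'.le (by linarith)
  have hVlo : (N : ℝ) ^ (σ - δf τ) ≤ (N : ℝ) ^ (σ - δ₀) :=
    Real.rpow_le_rpow_of_exponent_le hN1'.le (by linarith [hδ₀le τ hτF])
  have hVhi : (N : ℝ) ^ (σ - δ₀) ≤ (N : ℝ) ^ (σ + δf τ) :=
    Real.rpow_le_rpow_of_exponent_le hN1'.le (by linarith [hδ₀le τ hτF, hδ0 τ])
  have hB := hP τ N T ((N : ℝ) ^ (σ - δ₀)) b W hNC hTlo hThi hVlo hVhi hb hW hsep hla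
  -- `N^{κτ + ε/2} ≤ T^{κ + ε}`
  have hδτ : κ * δf τ ≤ ε / 2 := by
    have h1 : κ * δf τ ≤ κ * (ε / (2 * κ + 2)) := mul_le_mul_of_nonneg_left (hδle τ) hκ
    have h2 : κ * (ε / (2 * κ + 2)) ≤ ε / 2 := by
      rw [mul_div_assoc', div_le_div_iff₀ (by positivity) (by norm_num)]
      nlinarith
    exact h1.trans h2
  have hexp : (N : ℝ) ^ (κ * τ + ε / 2) ≤ T ^ (κ + ε) := by
    have e1 : κ * (τ : ℝ) + ε / 2 ≤ κ * τs + (κ * δf τ + ε / 2) := by nlinarith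
    calc (N : ℝ) ^ (κ * τ + ε / 2) ≤ (N : ℝ) ^ (κ * τs + (κ * δf τ + ε / 2)) :=
          Real.rpow_le_rpow_of_exponent_le hN1'.le e1
      _ = T ^ κ * (N : ℝ) ^ (κ * δf τ + ε / 2) := by
          rw [Real.rpow_add hN0, mul_comm κ τs, Real.rpow_mul hN0.le, hNτs]
      _ ≤ T ^ κ * T ^ (κ * δf τ + ε / 2) := by
          have hδτ0 : 0 < δf τ := hδ0 τ
          refine mul_le_mul_of_nonneg_left ?_ (by positivity)
          exact Real.rpow_le_rpow hN0.le hN2 (by positivity)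
      _ = T ^ (κ + (κ * δf τ + ε / 2)) := by rw [← Real.rpow_add hT0]
      _ ≤ T ^ (κ + ε) := Real.rpow_le_rpow_of_exponent_le hT1 (by linarith)
  calc (W.card : ℝ) ≤ Cf τ * (N : ℝ) ^ (κ * τ + ε / 2) := hB
    _ ≤ C₀ * T ^ (κ + ε) :=
        mul_le_mul (hCle τ hτF) hexp (by positivity) (by linarith)

/-- **Zero density from large value bounds, `τ₀ ≤ 3/2` (Tao–Trudgian–Yang, Corollary 43 with the
`ζ`-condition vacuous, in `LV`-language).** TTY Corollary 43: "Let `1/2 < σ < 1` and `τ₀ > 0`.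
Suppose that one has the bounds `LV(σ,τ) ≤ (3−3σ)τ/τ₀` for `2τ₀/3 ≤ τ ≤ τ₀`, and
`LV_ζ(σ,τ) ≤ (3−3σ)τ/τ₀` for `2 ≤ τ < 4τ₀/3`. Then `A(σ) ≤ 3/τ₀`." For `1 ≤ τ₀ ≤ 3/2` the second
condition is vacuous and the first is used only on `1 ≤ τ ≤ τ₀` (`⊂ [2τ₀/3, τ₀]`): the bounds
`LargeValueBound σ τ (τ(3−3σ)/τ₀)`, `1 ≤ τ ≤ τ₀`, give `N(σ,T) ≪_ε T^{(3/τ₀)(1−σ)+ε}`. PROVED: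
`largeValuesOnWindow_of_largeValueBound` (`α = 1/τ₀`, `κ = (3/τ₀)(1−σ)`) and the tree's window
zero detection `isBigO_zetaZeroCountRe_of_largeValuesOnWindow` (`ZeroDetectionWindow.lean`; TTY
Cor. 42 / Jutila 1977 §4), whose side conditions `κ ≥ 2 − 2σ`, `κ ≥ 3α(1−σ)` read `τ₀ ≤ 3/2`.
[cite: TaoTrudgianYang2025, Corollary 43 and the proof of Theorem 45] -/
theorem isBigO_zetaZeroCountRe_of_largeValueBound {σ τ₀ : ℝ} (h₁ : 1 / 2 < σ) (h₂ : σ < 1)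
    (hτ₀ : 1 ≤ τ₀) (hτ₀' : τ₀ ≤ 3 / 2)
    (h : ∀ τ : ℝ, 1 ≤ τ → τ ≤ τ₀ → LargeValueBound σ τ (τ * (3 - 3 * σ) / τ₀)) :
    ∀ ε > 0, (fun T : ℝ ↦ (zetaZeroCountRe σ T : ℝ)) =O[atTop]
      fun T : ℝ ↦ T ^ (3 / τ₀ * (1 - σ) + ε) := by
  have hτ₀0 : 0 < τ₀ := by linarith
  have hα : 0 < 1 / τ₀ := by positivity
  have hα1 : 1 / τ₀ ≤ 1 := by rw [div_le_one hτ₀0]; exact hτ₀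
  have hκ : 0 ≤ 3 / τ₀ * (1 - σ) := by
    have : 0 ≤ 1 - σ := by linarith
    positivity
  have h' : ∀ τ : ℝ, 1 ≤ τ → τ ≤ 1 / (1 / τ₀) → LargeValueBound σ τ (3 / τ₀ * (1 - σ) * τ) := by
    intro τ hτ1 hτ2
    rw [one_div_one_div] at hτ2
    have := h τ hτ1 hτ2
    rwa [show τ * (3 - 3 * σ) / τ₀ = 3 / τ₀ * (1 - σ) * τ by ring] at this
  have hLV := largeValuesOnWindow_of_largeValueBound hα hα1 hκ h'
  refine isBigO_zetaZeroCountRe_of_largeValuesOnWindow h₁ h₂ ?_ hα1 ?_ ?_ hLV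
  · rw [le_div_iff₀ hτ₀0]; linarith
  · rw [div_mul_eq_mul_div, le_div_iff₀ hτ₀0]; nlinarith
  · exact le_of_eq (by ring)


/-! ## The density hypothesis on `[25/32, 1]` from Bourgain's large values inequality (TTY Theorem 32 (ii)) -/

/-- Jutila's bound at `k = 3` dominated by a target `ρ`: if `2 − 2σ`, `τ + 10/3 − 16σ/3` and
`τ + 18 − 24σ` are `≤ ρ` then `LV(σ,τ) ≤ ρ` (`largeValueBound_jutila` with `k = 3` and
monotonicity). [cite: TaoTrudgianYang2025, display (jutila-lvt), k = 3] -/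
theorem largeValueBound_of_jutila_three {σ τ ρ : ℝ} (hσ : 1 / 2 ≤ σ) (hτ : 0 < τ)
    (h1 : 2 - 2 * σ ≤ ρ) (h2 : τ + 10 / 3 - 16 / 3 * σ ≤ ρ) (h3 : τ + 18 - 24 * σ ≤ ρ) :
    LargeValueBound σ τ ρ := by
  refine (largeValueBound_jutila 3 (by norm_num) hσ hτ).mono ?_
  push_cast
  refine max_le h1 (max_le ?_ ?_) <;> linarith

/-- The arithmetic of Tao–Trudgian–Yang's proof of Theorem 51 (case `38/49 ≤ σ ≤ 4/5`) run at
`τ₀ = 3/2` on the box `25/32 ≤ σ ≤ 11/14`, `1 ≤ τ ≤ 3/2`, in the regime `τ(2σ−1) ≥ 24σ − 18`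
where Jutila's bound does not suffice: with `α₂ = max(5τ/4 − (1+σ), 0)` and
`α₁ = τ/3 − (2/3)(7σ−5) − α₂/6` one has `α₁, α₂ ≥ 0` and all five terms of Theorem 32 (ii) are
`≤ 2τ(1−σ)` (at the corner `(σ, τ) = (25/32, 3/2)` the second, third and fourth terms equal
`2τ(1−σ) = 21/32` exactly). [cite: TaoTrudgianYang2025, proof of Theorem 51, pp. 19–20] -/
theorem bourgain_terms_le_two_mul {σ τ α₁ α₂ : ℝ} (hσ : 25 / 32 ≤ σ) (hσ' : σ ≤ 11 / 14)
    (hτ : 1 ≤ τ) (hτ' : τ ≤ 3 / 2) (hcase : 24 * σ - 18 ≤ τ * (2 * σ - 1))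
    (hα₂ : α₂ = max (5 * τ / 4 - (1 + σ)) 0) (hα₁ : α₁ = τ / 3 - 2 / 3 * (7 * σ - 5) - α₂ / 6) :
    0 ≤ α₁ ∧ 0 ≤ α₂ ∧
    max (α₂ + 2 - 2 * σ) (max (α₁ + α₂ / 2 + 2 - 2 * σ) (max (-α₂ + 2 * τ + 4 - 8 * σ)
      (max (-2 * α₁ + τ + 12 - 16 * σ) (4 * α₁ + 2 + max 1 (2 * τ - 2) - 4 * σ)))) ≤
      2 * τ * (1 - σ) := by
  have hm : max 1 (2 * τ - 2) = 1 := max_eq_left (by linarith)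
  rw [hm]
  have hQ : 0 ≤ (σ - 25 / 32) * (11 / 14 - σ) := mul_nonneg (by linarith) (by linarith)
  have h2σ : 0 < 2 * σ - 1 := by linarith
  rcases le_or_gt (5 * τ / 4 - (1 + σ)) 0 with h0 | h0
  · -- `α₂ = 0`
    have hα₂0 : α₂ = 0 := by rw [hα₂, max_eq_right h0]
    subst hα₂0
    have hα₁' : α₁ = τ / 3 - 2 / 3 * (7 * σ - 5) := by rw [hα₁]; ring
    subst hα₁'
    have hτ45 : τ ≤ (4 + 4 * σ) / 5 := by linarith
    -- `τ ≥ 14σ − 10` (from `τ(2σ−1) ≥ 24σ−18` and the `σ`-range)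
    have hA1 : 0 ≤ τ / 3 - 2 / 3 * (7 * σ - 5) := by nlinarith
    -- `16 − 20σ ≤ τ(5 − 6σ)`
    have hc : (5 - 6 * σ) * (24 * σ - 18) ≤ (5 - 6 * σ) * (τ * (2 * σ - 1)) :=
      mul_le_mul_of_nonneg_left hcase (by linarith)
    have hB2 : 16 - 20 * σ ≤ τ * (5 - 6 * σ) := by nlinarith
    -- `2τσ ≤ 8σ − 4`
    have hd : τ * σ ≤ (4 + 4 * σ) / 5 * σ := mul_le_mul_of_nonneg_right hτ45 (by linarith)
    have hB3 : 2 * τ * σ ≤ 8 * σ - 4 := by nlinarith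
    -- `49 − 68σ ≤ τ(2 − 6σ)`
    have he : 0 ≤ ((4 + 4 * σ) / 5 - τ) * (6 * σ - 2) := mul_nonneg (by linarith) (by linarith)
    have hB5 : 49 - 68 * σ ≤ τ * (2 - 6 * σ) := by nlinarith
    have hj : 0 ≤ (τ - 1) * (1 - σ) := mul_nonneg (by linarith) (by linarith)
    refine ⟨hA1, le_rfl, max_le ?_ (max_le ?_ (max_le ?_ (max_le ?_ ?_)))⟩
    · nlinarith
    · nlinarith
    · nlinarith
    · nlinarith
    · nlinarith
  · -- `α₂ = 5τ/4 − (1 + σ) > 0`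
    have hα₂' : α₂ = 5 * τ / 4 - (1 + σ) := by rw [hα₂, max_eq_left h0.le]
    subst hα₂'
    have hα₁' : α₁ = τ / 8 + (21 - 27 * σ) / 6 := by rw [hα₁]; ring
    subst hα₁'
    have hk : 0 ≤ (3 / 2 - τ) * (2 * σ - 3 / 4) := mul_nonneg (by linarith) (by linarith)
    have hk' : 0 ≤ (3 / 2 - τ) * (2 * σ - 5 / 4) := mul_nonneg (by linarith) (by linarith)
    have hk'' : 0 ≤ (3 / 2 - τ) * (2 * σ - 3 / 2) := mul_nonneg (by linarith) (by linarith)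
    refine ⟨by linarith, h0.le, max_le ?_ (max_le ?_ (max_le ?_ (max_le ?_ ?_)))⟩
    · nlinarith
    · nlinarith
    · nlinarith
    · nlinarith
    · nlinarith

/-- **`LV(σ, τ) ≤ 2τ(1 − σ)` on `25/32 ≤ σ ≤ 11/14`, `1 ≤ τ ≤ 3/2`, from Bourgain's large values
inequality** in the form of Tao–Trudgian–Yang's Theorem 32 (ii) (the hypothesis `h32`, unfolded:
"If we additionally assume `ρ ≤ min(1, 4−2τ)`, then `ρ ≤ max(α₂ + 2 − 2σ, α₁ + α₂/2 + 2 − 2σ,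
−α₂ + 2τ + 4 − 8σ, −2α₁ + τ + 12 − 16σ, 4α₁ + 2 + max(1, 2τ−2) − 4σ)`" for `ρ = LV(σ,τ)` and all
`α₁, α₂ ≥ 0`): when `τ(2σ−1) ≤ 24σ−18` this is Jutila's bound with `k = 3`
(`largeValueBound_of_jutila_three`); otherwise Jutila gives the a-priori bound
`LV(σ,τ) ≤ 1 = min(1, 4−2τ)` and `h32` with Tao–Trudgian–Yang's `α₁, α₂`
(`bourgain_terms_le_two_mul`) gives the claim. This is the large-values content of Bourgain's
density theorem (IMRN 2000) as organised in TTY's proof of Theorem 51.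
[cite: TaoTrudgianYang2025, Theorem 32 (ii) and proof of Theorem 51] [cite: Bourgain2000, main theorem] -/
theorem largeValueBound_two_mul_of_theorem_32
    (h32 : ∀ σ τ α₁ α₂ : ℝ, 1 / 2 < σ → σ < 1 → 0 < τ → 0 ≤ α₁ → 0 ≤ α₂ →
      LargeValueBound σ τ (min 1 (4 - 2 * τ)) →
      LargeValueBound σ τ (max (α₂ + 2 - 2 * σ) (max (α₁ + α₂ / 2 + 2 - 2 * σ)
        (max (-α₂ + 2 * τ + 4 - 8 * σ) (max (-2 * α₁ + τ + 12 - 16 * σ)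
          (4 * α₁ + 2 + max 1 (2 * τ - 2) - 4 * σ))))))
    {σ τ : ℝ} (hσ : 25 / 32 ≤ σ) (hσ' : σ ≤ 11 / 14) (hτ : 1 ≤ τ) (hτ' : τ ≤ 3 / 2) :
    LargeValueBound σ τ (2 * τ * (1 - σ)) := by
  have hj : 0 ≤ (τ - 1) * (1 - σ) := mul_nonneg (by linarith) (by linarith)
  rcases le_or_gt (τ * (2 * σ - 1)) (24 * σ - 18) with hA | hB
  · -- Jutila's regime
    refine largeValueBound_of_jutila_three (by linarith) (by linarith) ?_ ?_ ?_
    · nlinarith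
    · nlinarith
    · nlinarith
  · -- Bourgain's regime: a priori `LV ≤ 1 = min(1, 4 − 2τ)` from Jutila, then Theorem 32 (ii)
    have hap : LargeValueBound σ τ (min 1 (4 - 2 * τ)) :=
      largeValueBound_of_jutila_three (by linarith) (by linarith)
        (le_min (by linarith) (by linarith)) (le_min (by linarith) (by linarith))
        (le_min (by linarith) (by linarith))
    obtain ⟨hα₁, hα₂, hb⟩ := bourgain_terms_le_two_mul hσ hσ' hτ hτ' hB.le rfl rfl
    exact (h32 σ τ _ _ (by linarith) (by linarith) (by linarith) hα₁ hα₂ hap).mono hb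

/-- **Bourgain's density theorem from Bourgain's large values inequality: `A(σ) ≤ 2` on
`[25/32, 1]`**, i.e. `N(σ, T) ≪_ε T^{2(1−σ)+ε}` uniformly for `25/32 ≤ σ ≤ 1`
(`ZeroDensityEstimate (fun _ ↦ 2) (25/32)`, the literature floor S2 requested by the DensityLadder
route file), PROVED from the hypothesis `h32` = Tao–Trudgian–Yang Theorem 32 (ii) (Bourgain 2000,
stated for `ρ = LV(σ,τ)` via `LargeValueBound`; NOT a theorem of the tree — Bourgain's paper is a
separate corpus). TTY: "we recall a well-known result of Bourgain [bourgain_large_2000] that the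
density hypothesis `A(σ) ≤ 2` holds for all `σ > 25/32`"; their Theorem 51 gives the end point.
Assembly: on `[25/32, 11/14]`, `largeValueBound_two_mul_of_theorem_32` for `1 ≤ τ ≤ 3/2` and
Corollary 43 at `τ₀ = 3/2` (`isBigO_zetaZeroCountRe_of_largeValueBound`); on `[11/14, 1]` the
tree's unconditional `zeroDensity_jutila` (Jutila 1977). Same conclusion as
`zeroDensity_bourgain_of_theorem_51` (`ZeroDensityBourgain.lean`), resting on the large-values
inequality instead of the density statement.
[cite: Bourgain2000, main theorem (density hypothesis for σ > 25/32)] [cite: TaoTrudgianYang2025, Theorem 32 (ii), Corollary 43, Theorem 51] -/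
theorem zeroDensity_bourgain_of_theorem_32
    (h32 : ∀ σ τ α₁ α₂ : ℝ, 1 / 2 < σ → σ < 1 → 0 < τ → 0 ≤ α₁ → 0 ≤ α₂ →
      LargeValueBound σ τ (min 1 (4 - 2 * τ)) →
      LargeValueBound σ τ (max (α₂ + 2 - 2 * σ) (max (α₁ + α₂ / 2 + 2 - 2 * σ)
        (max (-α₂ + 2 * τ + 4 - 8 * σ) (max (-2 * α₁ + τ + 12 - 16 * σ)
          (4 * α₁ + 2 + max 1 (2 * τ - 2) - 4 * σ)))))) :
    ZeroDensityEstimate (fun _ ↦ 2) (25 / 32) := by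
  intro ε hε σ h₀ h₁
  rcases le_or_gt σ (11 / 14) with hle | hgt
  · have h := isBigO_zetaZeroCountRe_of_largeValueBound (σ := σ) (τ₀ := 3 / 2) (by linarith)
      (by linarith) (by norm_num) le_rfl (fun τ hτ hτ' ↦ by
        have := largeValueBound_two_mul_of_theorem_32 h32 h₀ hle hτ hτ'
        rwa [show 2 * τ * (1 - σ) = τ * (3 - 3 * σ) / (3 / 2) by ring] at this) ε hε
    rwa [show (3 : ℝ) / (3 / 2) = 2 by norm_num] at h
  · exact zeroDensity_jutila ε hε σ hgt.le h₁


/-! ## Tao–Trudgian–Yang's Theorem 51 exponent on the `ζ`-free range `17/22 ≤ σ ≤ 25/32` from Theorem 32 (ii)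

On `17/22 ≤ σ ≤ 25/32` one has `τ₀(σ) := min(9(3σ−2)/2, 8(2σ−1)/3) ≤ 3/2`, so Corollary 43 needs no
`LV_ζ` input, and `3/τ₀(σ) = max(2/(9σ−6), 9/(8(2σ−1)))` is the exponent of Theorem 51. The
printed human-readable proof obtains `LV(σ,τ) ≤ τ(3−3σ)/τ₀` for `2τ₀/3 ≤ τ ≤ τ₀` from "the `k = 3`
case of `(jutila-lvt)`" and, where that fails, Theorem 32 (ii); an exact check shows that these
two tools do NOT cover all of `[2τ₀/3, τ₀]` when `σ` is near `17/22` or `38/49` (e.g. at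
`σ = 17/22`, `τ = 21/20`: the target is `1/2`, Jutila with `k = 3` gives `0.5045…`, and the second
and fourth terms of Theorem 32 (ii) balance at `τ/3 + (16−20σ)/3 = 0.5318… > 1/2` for every
`α₁, α₂ ≥ 0`), while the `k = 4` case of `(jutila-lvt)` gives `5/11 < 1/2` there. Below, Jutila
with `k = 4` is used on `1 ≤ τ ≤ 27/20` and Theorem 32 (ii) with the printed case-wise
`α₂ = max(5τ/4 − (1+σ), 0)` (`σ ≥ 38/49`), `α₂ = max(11 − 16σ + τ, 0)` (`σ ≤ 38/49`),
`α₁ = τ/3 − (2/3)(7σ−5) − α₂/6` on `27/20 ≤ τ ≤ τ₀(σ)`; the theorem (computer-optimised by TTY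
over their whole table of large value theorems) is thereby confirmed on this range, from Jutila
1977 and Bourgain's inequality alone. -/

/-- Jutila's bound at `k = 4` dominated by a target `ρ`: if `2 − 2σ`, `τ + 7/2 − 11σ/2` and
`τ + 24 − 32σ` are `≤ ρ` then `LV(σ,τ) ≤ ρ`. [cite: TaoTrudgianYang2025, display (jutila-lvt), k = 4] -/
theorem largeValueBound_of_jutila_four {σ τ ρ : ℝ} (hσ : 1 / 2 ≤ σ) (hτ : 0 < τ)
    (h1 : 2 - 2 * σ ≤ ρ) (h2 : τ + 7 / 2 - 11 / 2 * σ ≤ ρ) (h3 : τ + 24 - 32 * σ ≤ ρ) :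
    LargeValueBound σ τ ρ := by
  refine (largeValueBound_jutila 4 (by norm_num) hσ hτ).mono ?_
  push_cast
  refine max_le h1 (max_le ?_ ?_) <;> linarith

/-- Case `38/49 ≤ σ ≤ 25/32` (`τ₀ = 8(2σ−1)/3`, target `τ(3−3σ)/τ₀ = 9τ(1−σ)/(8(2σ−1))`),
Bourgain branch `27/20 ≤ τ ≤ τ₀`: with Tao–Trudgian–Yang's `α₂ = max(5τ/4 − (1+σ), 0)`,
`α₁ = τ/3 − (2/3)(7σ−5) − α₂/6` one has `α₁, α₂ ≥ 0` and the five terms of Theorem 32 (ii) are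
`≤ 9τ(1−σ)/(8(2σ−1))` ((bound-1), (taut), (tar) of the printed proof; equalities at `τ = τ₀`).
[cite: TaoTrudgianYang2025, proof of Theorem 51, case 38/49 ≤ σ ≤ 4/5, pp. 19–20] -/
theorem bourgain_terms_le_case_one {σ τ α₁ α₂ : ℝ} (hσ : 38 / 49 ≤ σ) (hσ' : σ ≤ 25 / 32)
    (hτ : 27 / 20 ≤ τ) (hτ' : 3 * τ ≤ 8 * (2 * σ - 1))
    (hα₂ : α₂ = max (5 * τ / 4 - (1 + σ)) 0) (hα₁ : α₁ = τ / 3 - 2 / 3 * (7 * σ - 5) - α₂ / 6) :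
    0 ≤ α₁ ∧ 0 ≤ α₂ ∧
    max (α₂ + 2 - 2 * σ) (max (α₁ + α₂ / 2 + 2 - 2 * σ) (max (-α₂ + 2 * τ + 4 - 8 * σ)
      (max (-2 * α₁ + τ + 12 - 16 * σ) (4 * α₁ + 2 + max 1 (2 * τ - 2) - 4 * σ)))) ≤
      9 * τ * (1 - σ) / (8 * (2 * σ - 1)) := by
  have hτ32 : τ ≤ 3 / 2 := by linarith
  have hm : max 1 (2 * τ - 2) = 1 := max_eq_left (by linarith)
  rw [hm]
  have hu : 0 < 8 * (2 * σ - 1) := by linarith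
  have hQ : 0 ≤ (σ - 38 / 49) * (25 / 32 - σ) := mul_nonneg (by linarith) (by linarith)
  have hR : 0 ≤ (τ - 27 / 20) * (σ - 38 / 49) := mul_nonneg (by linarith) (by linarith)
  have hR' : 0 ≤ (τ - 27 / 20) * (25 / 32 - σ) := mul_nonneg (by linarith) (by linarith)
  have hT : 0 ≤ (8 * (2 * σ - 1) - 3 * τ) * (σ - 38 / 49) := mul_nonneg (by linarith) (by linarith)
  have hT' : 0 ≤ (8 * (2 * σ - 1) - 3 * τ) * (25 / 32 - σ) := mul_nonneg (by linarith) (by linarith)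
  rcases le_or_gt (5 * τ / 4 - (1 + σ)) 0 with h0 | h0
  · have hα₂0 : α₂ = 0 := by rw [hα₂, max_eq_right h0]
    subst hα₂0
    have hα₁' : α₁ = τ / 3 - 2 / 3 * (7 * σ - 5) := by rw [hα₁]; ring
    subst hα₁'
    have hL : 0 ≤ ((1 + σ) - 5 * τ / 4) * (σ - 38 / 49) := mul_nonneg (by linarith) (by linarith)
    have hL' : 0 ≤ ((1 + σ) - 5 * τ / 4) * (25 / 32 - σ) := mul_nonneg (by linarith) (by linarith)
    refine ⟨by nlinarith, le_rfl, max_le ?_ (max_le ?_ (max_le ?_ (max_le ?_ ?_)))⟩ <;>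
      rw [le_div_iff₀ hu] <;> nlinarith
  · have hα₂' : α₂ = 5 * τ / 4 - (1 + σ) := by rw [hα₂, max_eq_left h0.le]
    subst hα₂'
    have hα₁' : α₁ = τ / 8 + (21 - 27 * σ) / 6 := by rw [hα₁]; ring
    subst hα₁'
    have hL : 0 ≤ (5 * τ / 4 - (1 + σ)) * (σ - 38 / 49) := mul_nonneg (by linarith) (by linarith)
    have hL' : 0 ≤ (5 * τ / 4 - (1 + σ)) * (25 / 32 - σ) := mul_nonneg (by linarith) (by linarith)
    refine ⟨by nlinarith, h0.le, max_le ?_ (max_le ?_ (max_le ?_ (max_le ?_ ?_)))⟩ <;>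
      rw [le_div_iff₀ hu] <;> nlinarith

/-- Case `σ ≤ 38/49` (`τ₀ = 9(3σ−2)/2`, target `τ(3−3σ)/τ₀ = 2τ(1−σ)/(3(3σ−2))`; stated from
`σ ≥ 193/250`, slightly left of Theorem 51's end point `17/22`, to leave room for the window
`[σ−δ, σ]` of Definition 37), Bourgain branch `27/20 ≤ τ ≤ τ₀`: with Tao–Trudgian–Yang's `α₂ = max(11 − 16σ + τ, 0)`,
`α₁ = τ/3 − (2/3)(7σ−5) − α₂/6` one has `α₁, α₂ ≥ 0` and the five terms of Theorem 32 (ii) are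
`≤ 2τ(1−σ)/(3(3σ−2))`. [cite: TaoTrudgianYang2025, proof of Theorem 51, case 16/21 ≤ σ ≤ 38/49, p. 20] -/
theorem bourgain_terms_le_case_two {σ τ α₁ α₂ : ℝ} (hσ : 193 / 250 ≤ σ) (hσ' : σ ≤ 38 / 49)
    (hτ : 27 / 20 ≤ τ) (hτ' : 2 * τ ≤ 9 * (3 * σ - 2))
    (hα₂ : α₂ = max (11 - 16 * σ + τ) 0) (hα₁ : α₁ = τ / 3 - 2 / 3 * (7 * σ - 5) - α₂ / 6) :
    0 ≤ α₁ ∧ 0 ≤ α₂ ∧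
    max (α₂ + 2 - 2 * σ) (max (α₁ + α₂ / 2 + 2 - 2 * σ) (max (-α₂ + 2 * τ + 4 - 8 * σ)
      (max (-2 * α₁ + τ + 12 - 16 * σ) (4 * α₁ + 2 + max 1 (2 * τ - 2) - 4 * σ)))) ≤
      2 * τ * (1 - σ) / (3 * (3 * σ - 2)) := by
  have hτ32 : τ ≤ 3 / 2 := by linarith
  have hm : max 1 (2 * τ - 2) = 1 := max_eq_left (by linarith)
  rw [hm]
  have hu : 0 < 3 * (3 * σ - 2) := by linarith
  have hQ : 0 ≤ (σ - 193 / 250) * (38 / 49 - σ) := mul_nonneg (by linarith) (by linarith)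
  have hR : 0 ≤ (τ - 27 / 20) * (σ - 193 / 250) := mul_nonneg (by linarith) (by linarith)
  have hR' : 0 ≤ (τ - 27 / 20) * (38 / 49 - σ) := mul_nonneg (by linarith) (by linarith)
  have hT : 0 ≤ (9 * (3 * σ - 2) - 2 * τ) * (σ - 193 / 250) := mul_nonneg (by linarith) (by linarith)
  have hT' : 0 ≤ (9 * (3 * σ - 2) - 2 * τ) * (38 / 49 - σ) := mul_nonneg (by linarith) (by linarith)
  rcases le_or_gt (11 - 16 * σ + τ) 0 with h0 | h0
  · have hα₂0 : α₂ = 0 := by rw [hα₂, max_eq_right h0]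
    subst hα₂0
    have hα₁' : α₁ = τ / 3 - 2 / 3 * (7 * σ - 5) := by rw [hα₁]; ring
    subst hα₁'
    have hL : 0 ≤ (16 * σ - 11 - τ) * (σ - 193 / 250) := mul_nonneg (by linarith) (by linarith)
    have hL' : 0 ≤ (16 * σ - 11 - τ) * (38 / 49 - σ) := mul_nonneg (by linarith) (by linarith)
    refine ⟨by nlinarith, le_rfl, max_le ?_ (max_le ?_ (max_le ?_ (max_le ?_ ?_)))⟩ <;>
      rw [le_div_iff₀ hu] <;> nlinarith
  · have hα₂' : α₂ = 11 - 16 * σ + τ := by rw [hα₂, max_eq_left h0.le]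
    subst hα₂'
    have hα₁' : α₁ = τ / 6 + (9 - 12 * σ) / 6 := by rw [hα₁]; ring
    subst hα₁'
    have hL : 0 ≤ (11 - 16 * σ + τ) * (σ - 193 / 250) := mul_nonneg (by linarith) (by linarith)
    have hL' : 0 ≤ (11 - 16 * σ + τ) * (38 / 49 - σ) := mul_nonneg (by linarith) (by linarith)
    refine ⟨by nlinarith, h0.le, max_le ?_ (max_le ?_ (max_le ?_ (max_le ?_ ?_)))⟩ <;>
      rw [le_div_iff₀ hu] <;> nlinarith

/-- **`LV(σ,τ) ≤ τ(3−3σ)/τ₀(σ)` for `38/49 ≤ σ ≤ 25/32`, `1 ≤ τ ≤ τ₀(σ) = 8(2σ−1)/3`, from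
Theorem 32 (ii)** (`h32`): Jutila's bound with `k = 4` on `τ ≤ 27/20`, else the a-priori bound
`LV ≤ 1` (Jutila) and `h32` with `bourgain_terms_le_case_one`.
[cite: TaoTrudgianYang2025, proof of Theorem 51, display (lv-st), case 38/49 ≤ σ] -/
theorem largeValueBound_case_one_of_theorem_32
    (h32 : ∀ σ τ α₁ α₂ : ℝ, 1 / 2 < σ → σ < 1 → 0 < τ → 0 ≤ α₁ → 0 ≤ α₂ →
      LargeValueBound σ τ (min 1 (4 - 2 * τ)) →
      LargeValueBound σ τ (max (α₂ + 2 - 2 * σ) (max (α₁ + α₂ / 2 + 2 - 2 * σ)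
        (max (-α₂ + 2 * τ + 4 - 8 * σ) (max (-2 * α₁ + τ + 12 - 16 * σ)
          (4 * α₁ + 2 + max 1 (2 * τ - 2) - 4 * σ))))))
    {σ τ : ℝ} (hσ : 38 / 49 ≤ σ) (hσ' : σ ≤ 25 / 32) (hτ : 1 ≤ τ)
    (hτ' : 3 * τ ≤ 8 * (2 * σ - 1)) :
    LargeValueBound σ τ (9 * τ * (1 - σ) / (8 * (2 * σ - 1))) := by
  have hu : 0 < 8 * (2 * σ - 1) := by linarith
  have hQ : 0 ≤ (σ - 38 / 49) * (25 / 32 - σ) := mul_nonneg (by linarith) (by linarith)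
  rcases le_or_gt τ (27 / 20) with hA | hB
  · -- Jutila's bound with `k = 4`
    have h1 : 0 ≤ (τ - 1) * (σ - 38 / 49) := mul_nonneg (by linarith) (by linarith)
    have h2 : 0 ≤ (27 / 20 - τ) * (σ - 38 / 49) := mul_nonneg (by linarith) (by linarith)
    have h3 : 0 ≤ (27 / 20 - τ) * (25 / 32 - σ) := mul_nonneg (by linarith) (by linarith)
    refine largeValueBound_of_jutila_four (by linarith) (by linarith) ?_ ?_ ?_ <;>
      rw [le_div_iff₀ hu] <;> nlinarith
  · -- Bourgain's regime
    have hap : LargeValueBound σ τ (min 1 (4 - 2 * τ)) :=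
      largeValueBound_of_jutila_four (by linarith) (by linarith)
        (le_min (by linarith) (by linarith)) (le_min (by linarith) (by linarith))
        (le_min (by linarith) (by linarith))
    obtain ⟨hα₁, hα₂, hb⟩ := bourgain_terms_le_case_one hσ hσ' hB.le hτ' rfl rfl
    exact (h32 σ τ _ _ (by linarith) (by linarith) (by linarith) hα₁ hα₂ hap).mono hb

/-- **`LV(σ,τ) ≤ τ(3−3σ)/τ₀(σ)` for `193/250 ≤ σ ≤ 38/49`, `1 ≤ τ ≤ τ₀(σ) = 9(3σ−2)/2`, from
Theorem 32 (ii)** (`h32`): Jutila's bound with `k = 4` on `τ ≤ 27/20`, else the a-priori bound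
`LV ≤ 1` (Jutila) and `h32` with `bourgain_terms_le_case_two`.
[cite: TaoTrudgianYang2025, proof of Theorem 51, display (lv-st), case σ ≤ 38/49] -/
theorem largeValueBound_case_two_of_theorem_32
    (h32 : ∀ σ τ α₁ α₂ : ℝ, 1 / 2 < σ → σ < 1 → 0 < τ → 0 ≤ α₁ → 0 ≤ α₂ →
      LargeValueBound σ τ (min 1 (4 - 2 * τ)) →
      LargeValueBound σ τ (max (α₂ + 2 - 2 * σ) (max (α₁ + α₂ / 2 + 2 - 2 * σ)
        (max (-α₂ + 2 * τ + 4 - 8 * σ) (max (-2 * α₁ + τ + 12 - 16 * σ)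
          (4 * α₁ + 2 + max 1 (2 * τ - 2) - 4 * σ))))))
    {σ τ : ℝ} (hσ : 193 / 250 ≤ σ) (hσ' : σ ≤ 38 / 49) (hτ : 1 ≤ τ)
    (hτ' : 2 * τ ≤ 9 * (3 * σ - 2)) :
    LargeValueBound σ τ (2 * τ * (1 - σ) / (3 * (3 * σ - 2))) := by
  have hu : 0 < 3 * (3 * σ - 2) := by linarith
  have hQ : 0 ≤ (σ - 193 / 250) * (38 / 49 - σ) := mul_nonneg (by linarith) (by linarith)
  rcases le_or_gt τ (27 / 20) with hA | hB
  · -- Jutila's bound with `k = 4`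
    have h1 : 0 ≤ (τ - 1) * (σ - 193 / 250) := mul_nonneg (by linarith) (by linarith)
    have h2 : 0 ≤ (27 / 20 - τ) * (σ - 193 / 250) := mul_nonneg (by linarith) (by linarith)
    have h3 : 0 ≤ (27 / 20 - τ) * (38 / 49 - σ) := mul_nonneg (by linarith) (by linarith)
    refine largeValueBound_of_jutila_four (by linarith) (by linarith) ?_ ?_ ?_ <;>
      rw [le_div_iff₀ hu] <;> nlinarith
  · -- Bourgain's regime
    have hap : LargeValueBound σ τ (min 1 (4 - 2 * τ)) :=
      largeValueBound_of_jutila_four (by linarith) (by linarith)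
        (le_min (by linarith) (by linarith)) (le_min (by linarith) (by linarith))
        (le_min (by linarith) (by linarith))
    obtain ⟨hα₁, hα₂, hb⟩ := bourgain_terms_le_case_two hσ hσ' hB.le hτ' rfl rfl
    exact (h32 σ τ _ _ (by linarith) (by linarith) (by linarith) hα₁ hα₂ hap).mono hb

/-- Theorem 51's exponent from `h32`, pointwise in `σ`, on the slightly larger range
`193/250 ≤ σ ≤ 25/32` (room for the window of Definition 37); see
`isBigO_zetaZeroCountRe_theorem_51_of_theorem_32`. [cite: TaoTrudgianYang2025, Theorem 51 and its proof, pp. 19–20] -/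
theorem isBigO_zetaZeroCountRe_theorem_51_of_theorem_32_aux
    (h32 : ∀ σ τ α₁ α₂ : ℝ, 1 / 2 < σ → σ < 1 → 0 < τ → 0 ≤ α₁ → 0 ≤ α₂ →
      LargeValueBound σ τ (min 1 (4 - 2 * τ)) →
      LargeValueBound σ τ (max (α₂ + 2 - 2 * σ) (max (α₁ + α₂ / 2 + 2 - 2 * σ)
        (max (-α₂ + 2 * τ + 4 - 8 * σ) (max (-2 * α₁ + τ + 12 - 16 * σ)
          (4 * α₁ + 2 + max 1 (2 * τ - 2) - 4 * σ))))))
    {σ : ℝ} (hσ : 193 / 250 ≤ σ) (hσ' : σ ≤ 25 / 32) :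
    ∀ ε > 0, (fun T : ℝ ↦ (zetaZeroCountRe σ T : ℝ)) =O[atTop]
      fun T : ℝ ↦ T ^ (max (2 / (9 * σ - 6)) (9 / (8 * (2 * σ - 1))) * (1 - σ) + ε) := by
  intro ε hε
  have h9 : 0 < 9 * σ - 6 := by linarith
  have h8 : 0 < 8 * (2 * σ - 1) := by linarith
  rcases le_or_gt (38 / 49) σ with h38 | h38
  · -- `τ₀ = 8(2σ−1)/3`, `3/τ₀ = 9/(8(2σ−1))`
    have hmax : max (2 / (9 * σ - 6)) (9 / (8 * (2 * σ - 1))) = 9 / (8 * (2 * σ - 1)) := by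
      refine max_eq_right ?_
      rw [div_le_div_iff₀ h9 h8]; linarith
    have h := isBigO_zetaZeroCountRe_of_largeValueBound (σ := σ) (τ₀ := 8 * (2 * σ - 1) / 3)
      (by linarith) (by linarith) (by linarith) (by linarith) (fun τ hτ hτ' ↦ by
        have := largeValueBound_case_one_of_theorem_32 h32 h38 hσ' hτ (by linarith)
        rwa [show 9 * τ * (1 - σ) / (8 * (2 * σ - 1)) =
          τ * (3 - 3 * σ) / (8 * (2 * σ - 1) / 3) by rw [div_div_eq_mul_div]; ring] at this) ε hε
    refine h.congr_right fun T ↦ ?_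
    rw [hmax, show (3 : ℝ) / (8 * (2 * σ - 1) / 3) = 9 / (8 * (2 * σ - 1)) by
      rw [div_div_eq_mul_div]; ring]
  · -- `τ₀ = 9(3σ−2)/2`, `3/τ₀ = 2/(9σ−6)`
    have hmax : max (2 / (9 * σ - 6)) (9 / (8 * (2 * σ - 1))) = 2 / (9 * σ - 6) := by
      refine max_eq_left ?_
      rw [div_le_div_iff₀ h8 h9]; linarith
    have h := isBigO_zetaZeroCountRe_of_largeValueBound (σ := σ) (τ₀ := 9 * (3 * σ - 2) / 2)
      (by linarith) (by linarith) (by linarith) (by linarith) (fun τ hτ hτ' ↦ by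
        have := largeValueBound_case_two_of_theorem_32 h32 hσ h38.le hτ (by linarith)
        rwa [show 2 * τ * (1 - σ) / (3 * (3 * σ - 2)) =
          τ * (3 - 3 * σ) / (9 * (3 * σ - 2) / 2) by
            rw [div_div_eq_mul_div, div_eq_div_iff (by linarith : (0 : ℝ) < 3 * (3 * σ - 2)).ne'
              (by linarith : (0 : ℝ) < 9 * (3 * σ - 2)).ne']; ring] at this)
      ε hε
    refine h.congr_right fun T ↦ ?_
    rw [hmax, show (3 : ℝ) / (9 * (3 * σ - 2) / 2) = 2 / (9 * σ - 6) by
      rw [div_div_eq_mul_div, div_eq_div_iff (by linarith : (0 : ℝ) < 9 * (3 * σ - 2)).ne' h9.ne']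
      ring]


/-- **Tao–Trudgian–Yang's Theorem 51 exponent on `17/22 ≤ σ ≤ 25/32`, from Bourgain's large
values inequality (Theorem 32 (ii), hypothesis `h32`)**: `N(σ, T) ≪_ε T^{A(σ)(1−σ)+ε}` with
`A(σ) = max(2/(9σ−6), 9/(8(2σ−1)))` (the printed exponent; `= 3/τ₀(σ)`), for every fixed `σ` in
that range — the part of Theorem 51 ("For fixed `17/22 ≤ σ ≤ 4/5`, one has
`A(σ) ≤ max(2/(9σ−6), 9/(8(2σ−1)))`") on which `τ₀(σ) ≤ 3/2`, so that Corollary 43 needs no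
`LV_ζ` input; in the tree's pointwise convention for `A(σ)` (TTY's Definition 37 additionally asks
for uniformity in a window `[σ−δ, σ]`; the tree's BOUNDARY fact `TaoTrudgianYang2025_theorem_51`
keeps the printed range and form). For `σ > 25/32` the exponent is `< 2` and needs the twelfth
moment (`LV_ζ`), not available to the tree's detection. PROVED: `largeValueBound_case_one/two_of_theorem_32`
and `isBigO_zetaZeroCountRe_of_largeValueBound` at `τ₀(σ) = 8(2σ−1)/3`, resp. `9(3σ−2)/2`.
[cite: TaoTrudgianYang2025, Theorem 51 (range 17/22 ≤ σ ≤ 25/32) and its proof, pp. 19–20] -/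
theorem isBigO_zetaZeroCountRe_theorem_51_of_theorem_32
    (h32 : ∀ σ τ α₁ α₂ : ℝ, 1 / 2 < σ → σ < 1 → 0 < τ → 0 ≤ α₁ → 0 ≤ α₂ →
      LargeValueBound σ τ (min 1 (4 - 2 * τ)) →
      LargeValueBound σ τ (max (α₂ + 2 - 2 * σ) (max (α₁ + α₂ / 2 + 2 - 2 * σ)
        (max (-α₂ + 2 * τ + 4 - 8 * σ) (max (-2 * α₁ + τ + 12 - 16 * σ)
          (4 * α₁ + 2 + max 1 (2 * τ - 2) - 4 * σ))))))
    {σ : ℝ} (hσ : 17 / 22 ≤ σ) (hσ' : σ ≤ 25 / 32) :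
    ∀ ε > 0, (fun T : ℝ ↦ (zetaZeroCountRe σ T : ℝ)) =O[atTop]
      fun T : ℝ ↦ T ^ (max (2 / (9 * σ - 6)) (9 / (8 * (2 * σ - 1))) * (1 - σ) + ε) :=
  isBigO_zetaZeroCountRe_theorem_51_of_theorem_32_aux h32 (le_trans (by norm_num) hσ) hσ'


/-- Continuity of Theorem 51's exponent to the left: for `17/22 ≤ σ ≤ 25/32` and
`0 ≤ δ ≤ 1/1375`, `max(2/(9σ'−6), 9/(8(2σ'−1)))(1−σ') ≤ max(2/(9σ−6), 9/(8(2σ−1)))(1−σ) + 8δ`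
with `σ' = σ − δ` (the two pieces move by `6δ/((9σ'−6)(9σ−6))` and `9δ/(8(2σ'−1)(2σ−1))`);
private plumbing for the window of Definition 37. [folklore] -/
private lemma ttyExponent51_sub_le {σ δ : ℝ} (hσ : 17 / 22 ≤ σ) (hσ' : σ ≤ 25 / 32)
    (hδ0 : 0 ≤ δ) (hδ : δ ≤ 1 / 1375) :
    max (2 / (9 * (σ - δ) - 6)) (9 / (8 * (2 * (σ - δ) - 1))) * (1 - (σ - δ)) ≤
      max (2 / (9 * σ - 6)) (9 / (8 * (2 * σ - 1))) * (1 - σ) + 8 * δ := by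
  have hd : 0 < 9 * σ - 6 := by linarith
  have hd' : 0 < 9 * (σ - δ) - 6 := by linarith
  have he : 0 < 8 * (2 * σ - 1) := by linarith
  have he' : 0 < 8 * (2 * (σ - δ) - 1) := by linarith
  have h1σ : 0 ≤ 1 - σ := by linarith
  have h1σ' : 0 ≤ 1 - (σ - δ) := by linarith
  rw [max_mul_of_nonneg _ _ h1σ', max_mul_of_nonneg _ _ h1σ]
  refine max_le ?_ ?_
  · have e1 : 2 / (9 * (σ - δ) - 6) * (1 - (σ - δ)) =
        2 / (9 * σ - 6) * (1 - σ) + 6 * δ / ((9 * (σ - δ) - 6) * (9 * σ - 6)) := by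
      field_simp
      ring
    have e2 : 6 * δ / ((9 * (σ - δ) - 6) * (9 * σ - 6)) ≤ 8 * δ := by
      rw [div_le_iff₀ (mul_pos hd' hd)]
      have : (9 / 10 : ℝ) * (9 / 10) ≤ (9 * (σ - δ) - 6) * (9 * σ - 6) :=
        mul_le_mul (by linarith) (by linarith) (by norm_num) (by linarith)
      nlinarith
    calc 2 / (9 * (σ - δ) - 6) * (1 - (σ - δ))
        ≤ 2 / (9 * σ - 6) * (1 - σ) + 8 * δ := by rw [e1]; linarith
      _ ≤ max (2 / (9 * σ - 6) * (1 - σ)) (9 / (8 * (2 * σ - 1)) * (1 - σ)) + 8 * δ := by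
          linarith [le_max_left (2 / (9 * σ - 6) * (1 - σ)) (9 / (8 * (2 * σ - 1)) * (1 - σ))]
  · have hne1 : 2 * (σ - δ) - 1 ≠ 0 := by
      intro h; linarith
    have hne2 : 2 * σ - 1 ≠ 0 := by
      intro h; linarith
    have e1 : 9 / (8 * (2 * (σ - δ) - 1)) * (1 - (σ - δ)) =
        9 / (8 * (2 * σ - 1)) * (1 - σ) + 9 * δ / (8 * ((2 * (σ - δ) - 1) * (2 * σ - 1))) := by
      field_simp
      ring
    have hp : 0 < (2 * (σ - δ) - 1) * (2 * σ - 1) := mul_pos (by linarith) (by linarith)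
    have e2 : 9 * δ / (8 * ((2 * (σ - δ) - 1) * (2 * σ - 1))) ≤ 8 * δ := by
      rw [div_le_iff₀ (by positivity)]
      have : (1 / 2 : ℝ) * (1 / 2) ≤ (2 * (σ - δ) - 1) * (2 * σ - 1) :=
        mul_le_mul (by linarith) (by linarith) (by norm_num) (by linarith)
      nlinarith
    calc 9 / (8 * (2 * (σ - δ) - 1)) * (1 - (σ - δ))
        ≤ 9 / (8 * (2 * σ - 1)) * (1 - σ) + 8 * δ := by rw [e1]; linarith
      _ ≤ max (2 / (9 * σ - 6) * (1 - σ)) (9 / (8 * (2 * σ - 1)) * (1 - σ)) + 8 * δ := by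
          linarith [le_max_right (2 / (9 * σ - 6) * (1 - σ)) (9 / (8 * (2 * σ - 1)) * (1 - σ))]

/-- **Tao–Trudgian–Yang's Theorem 51 on `17/22 ≤ σ ≤ 25/32` IN THE PRINTED FORM of their
Definition 37, from Bourgain's large values inequality (Theorem 32 (ii), hypothesis `h32`)**:
"`A(σ) ≤ max(2/(9σ−6), 9/(8(2σ−1)))`", i.e. for every `ε > 0` there exist `C, δ > 0` such that
`N(σ−δ, T) ≤ C T^{A(1−σ)+ε}` whenever `T ≥ C` (with the tree's count `N = zetaZeroCountRe`). This
is LITERALLY the body of the tree's BOUNDARY fact `TaoTrudgianYang2025_theorem_51`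
(`ZeroDensityBourgain.lean`) with its range `σ ≤ 4/5` cut back to `σ ≤ 25/32` — the sub-range on
which `τ₀(σ) ≤ 3/2` and TTY's proof uses no `LV_ζ` (twelfth-moment) input; on `(25/32, 4/5]` the
fact is NOT derivable from `h32` and the tree. PROVED: the pointwise bound at `σ' = σ − δ`
(`isBigO_zetaZeroCountRe_theorem_51_of_theorem_32_aux`, valid from `σ' ≥ 193/250`) with `ε/2`,
`δ = min(1/1375, ε/32)`, and `A(σ')(1−σ') ≤ A(σ)(1−σ) + 8δ` (`ttyExponent51_sub_le`).
[cite: TaoTrudgianYang2025, Theorem 51 (range 17/22 ≤ σ ≤ 25/32), Definition 37, pp. 16, 19–20] -/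
theorem TaoTrudgianYang2025.theorem_51_of_theorem_32_le
    (h32 : ∀ σ τ α₁ α₂ : ℝ, 1 / 2 < σ → σ < 1 → 0 < τ → 0 ≤ α₁ → 0 ≤ α₂ →
      LargeValueBound σ τ (min 1 (4 - 2 * τ)) →
      LargeValueBound σ τ (max (α₂ + 2 - 2 * σ) (max (α₁ + α₂ / 2 + 2 - 2 * σ)
        (max (-α₂ + 2 * τ + 4 - 8 * σ) (max (-2 * α₁ + τ + 12 - 16 * σ)
          (4 * α₁ + 2 + max 1 (2 * τ - 2) - 4 * σ)))))) :
    ∀ σ : ℝ, 17 / 22 ≤ σ → σ ≤ 25 / 32 → ∀ ε : ℝ, 0 < ε → ∃ C δ : ℝ, 0 < δ ∧ ∀ T : ℝ, C ≤ T →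
      (zetaZeroCountRe (σ - δ) T : ℝ) ≤
        C * T ^ (max (2 / (9 * σ - 6)) (9 / (8 * (2 * σ - 1))) * (1 - σ) + ε) := by
  intro σ hσ hσ' ε hε
  obtain ⟨δ, hδdef⟩ : ∃ δ : ℝ, min (1 / 1375) (ε / 32) = δ := ⟨_, rfl⟩
  have hδ0 : 0 < δ := by rw [← hδdef]; positivity
  have hδ1 : δ ≤ 1 / 1375 := hδdef ▸ min_le_left _ _
  have hδ2 : δ ≤ ε / 32 := hδdef ▸ min_le_right _ _
  -- the pointwise bound at `σ − δ` with `ε/2`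
  have hpt := isBigO_zetaZeroCountRe_theorem_51_of_theorem_32_aux h32 (σ := σ - δ)
    (by linarith) (by linarith) (ε / 2) (by linarith)
  obtain ⟨c, hc0, hc⟩ := hpt.exists_pos
  rw [Asymptotics.IsBigOWith_def] at hc
  obtain ⟨T₁, hT₁⟩ := Filter.eventually_atTop.1 hc
  refine ⟨max c (max T₁ 1), δ, hδ0, fun T hT ↦ ?_⟩
  have hT1 : 1 ≤ T := le_trans ((le_max_right _ _).trans (le_max_right _ _)) hT
  have hT0 : 0 < T := by linarith
  have hTT₁ : T₁ ≤ T := le_trans ((le_max_left _ _).trans (le_max_right _ _)) hT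
  have h1 := hT₁ T hTT₁
  rw [Real.norm_of_nonneg (Nat.cast_nonneg _), Real.norm_of_nonneg (Real.rpow_nonneg hT0.le _)]
    at h1
  have hexp : max (2 / (9 * (σ - δ) - 6)) (9 / (8 * (2 * (σ - δ) - 1))) * (1 - (σ - δ)) + ε / 2 ≤
      max (2 / (9 * σ - 6)) (9 / (8 * (2 * σ - 1))) * (1 - σ) + ε := by
    have := ttyExponent51_sub_le hσ hσ' hδ0.le hδ1
    linarith
  calc (zetaZeroCountRe (σ - δ) T : ℝ)
      ≤ c * T ^ (max (2 / (9 * (σ - δ) - 6)) (9 / (8 * (2 * (σ - δ) - 1))) * (1 - (σ - δ)) +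
          ε / 2) := h1
    _ ≤ c * T ^ (max (2 / (9 * σ - 6)) (9 / (8 * (2 * σ - 1))) * (1 - σ) + ε) :=
        mul_le_mul_of_nonneg_left (Real.rpow_le_rpow_of_exponent_le hT1 hexp) hc0.le
    _ ≤ max c (max T₁ 1) * T ^ (max (2 / (9 * σ - 6)) (9 / (8 * (2 * σ - 1))) * (1 - σ) + ε) :=
        mul_le_mul_of_nonneg_right (le_max_left _ _) (by positivity)

end Literature.NumberTheory.LFunctions

end
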